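import Literature.AlgebraicGeometry.HodgeTheory.RankOneCentreTimesCMCurveProductSpan
import Literature.AlgebraicGeometry.HodgeTheory.DivisorClassesHardLefschetz
import Literature.AlgebraicGeometry.Motives.HodgeThetaAnnihilatorUnitaryTimesCMCurve
import HarnessLib

/-!
# `Y × E`, `Y` of unitary type `(dim Y − 1, 1)` over `k' = ℚ(√-d)`, `E` ANY elliptic curve with complex multiplication — the RESONANT case `k ↪ End⁰(Y)` included: `B•(Y × E) = D•(Y × E)` and the Hodge conjecture for `Y × E` (Moonen–Zarhin 1999 Thm. 0.2 (3) case (g), §5 (5.11) Case 2, (5.12))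

Family `hodge`, layer `Literature/AlgebraicGeometry/HodgeTheory`. Research context: cell `pub-hodge-ring2` (HONEST
FRAMING: research route conditional on HC_CM; not a corollary; Q11.4-sentence-2 already refuted in dim ≥ 3),
Literature lane, programme R29 — the geometric file drawing the consequences of the Lie step
`Motives/HodgeThetaAnnihilatorUnitaryTimesCMCurve` (the annihilator of a Hodge class of `(H¹(Y) ⊕ H¹(E))^{⊗}` contains
`ι_Y [Y₁, Y₂] π_Y` for all `Y₁, Y₂ ∈ 𝔲_{k'}(H¹Y, ψ)_ℂ`, WITHOUT the non-resonance `d ≠ q²d'` of the tree's programme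
R24 `RankOneCentreTimesCMCurveInvariance` / `RankOneCentreTimesCMCurveProductSpan`). UNCONDITIONAL (no HC_CM);
theorems only (no definition, no named fact, D-0026; nothing admitted); no step towards a summit statement beyond
the printed results it formalizes.

PRINTED RESULTS. B. Moonen, Yu. Zarhin, *Hodge classes on abelian varieties of low dimension*, Math. Ann. 315
(1999) 711–733 [held: `paper:arxiv-math_9901113`, locators = held TeX chunks]. Thm. 0.2 (chunks p0001–p0002), case
(g): «The abelian variety `X` is isogenous to a product `X₁ × X₂` where `X₁` is an elliptic curve with complex
multiplication by an imaginary quadratic field `k` and where `X₂` is a simple abelian fourfold such that there exists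
an embedding `k ↪ End⁰(X₂)` via which `k` acts on `T_{X₂,0}` with multiplicities `(1,3)`», and (3): «Suppose we are
in case (g). Then the Hodge ring `B•(X)` is generated by divisor classes, i.e., `B•(X) = D•(X)`. The Hodge group
`Hg(X)` is strictly contained in `Sp_D(V,φ)`». §5 (5.11) Case 2 (chunks p0010–p0011): «Suppose that `k` acts on
`T_{Y,0}` with multiplicities `(1,3)` … Rather than looking at `E × Y`, let us look at `Z := E² × Y` … the
corresponding space of Weil classes `W_k ⊂ H⁶(Z,ℚ)` consists of Hodge classes … `Hg(X)` is contained in the subgroup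
`H = {(u₁,u₂) ∈ U_k × U_F(V_Y,ψ) ∣ u₁² · det_k(u₂) = 1}` … we conclude that `Hg(X) = H`». §5 (5.12) (chunk p0011):
«Finally, suppose we are in case (g). Again we only have to look at `H⁴(X,ℚ)`. The only interesting Künneth
component in this case is `H¹(X₁,ℚ) ⊗ H³(X₂,ℚ)`. As we have shown, `Hg(X) = {(u₁,u₂) ∈ U_k × Hg(Y) ∣ u₁² · det_k(u₂) =
1}`. In particular we have an element `(-1,1) ∈ Hg(X)` which acts on `H¹(X₁,ℚ) ⊗ H³(X₂,ℚ)` as `-1`. This shows there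
are no Hodge classes in `H¹(X₁,ℚ) ⊗ H³(X₂,ℚ)` and that `B•(X)` is generated by divisor classes.»

THIS FILE (Lie-algebra form of `Hg(X) ⊇ {1} × SU_{k'}(V_Y,ψ)`, valid for all multiplicities `(m,1)`, `m ≥ 3`). §1 the
WORD-COMBINATORIAL CORE `sum_kindSign_inl_eq_zero_of_rootDiffWeights`: on ONE copy of `H¹(Y) ⊕ H¹(E)`, a word without
repeated letters which is `Θ`-balanced and killed by all root-difference weights `E_ii - E_jj` of `𝔰𝔩(W)`
(`W = ker(φ - μ)`, `dim(W ∩ H^{1,0}) - dim(W ∩ H^{0,1}) ≥ 2`) is `Y`-kind balanced (the `E`-kind weight has absolute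
value `≤ 1`) — the tree's rendering of «`(-1,1)` acts as `-1`» that does not need `dim Y = 4`. §2 antisymmetry is
transported along `placeRefine` (`IsAntisymm.placeRefine`). §3 THE INVARIANCE THEOREM
`AVSlots.exists_coeff_eq_zero_off_balanced_of_prod_unitaryTypeOne_cmCurve`: `Y` with `dim Y ≥ 4`,
`dim_ℚ End⁰(Y) = 2`, `φ ≫ φ = -d`, multiplicity `1` at `i√d` or `-i√d`; `E` an elliptic curve with `χ ≫ χ = -d'` — NO
condition relating `d`, `d'` —; `X` with ONE slot over `Y × E`: every rational `(p,p)`-class on `X` has, in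
Hodge-adapted pair bases, a letter expansion vanishing off the `Y`-kind-balanced words (the conclusion of the tree's
`AVSlots.exists_coeff_eq_zero_off_balanced_of_prod_quadraticEnd_cmCurve`, verbatim). Proof: R24's pipeline up to the
antisymmetric kind-balanced coefficient function killed by the Hodge–theta algebra, the Lie step (loc. cit.) for the
brackets `[P, P']` of the elementary `φ_ℂ`-commuting `ψ_ℂ`-skew operators `P = E_{ij} ⊕ (-E_{ji})^t` on an adapted
`ψ_ℂ`-dual basis (`UnitaryTheta.exists_adaptedDualBasis`), whose brackets `[P_{ij}, P_{ji}] = E_ii - E_jj` act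
diagonally, then §1. §4 the PRODUCT SPAN `HodgeClassesProductSpan B Z` for one slot over `Y` and one over `E`
(`hodgeClassesProductSpan_of_avSlots_one_of_unitaryTypeOne_cmCurve`; the typed-Künneth pipeline of the tree's
`hodgeClassesProductSpan_of_avSlots_of_quadraticEnd_cmCurve`, verbatim) and for `Y × E` itself. §5 **`B•(Y × E) =
D•(Y × E)`** (`isDivisorGenerated_prod_cmCurve_of_unitaryTypeOne`: product span + the tree's
`AbelianVariety.isDivisorGenerated_of_ribetTypeOne` for `Y` + `dim E ≤ 3`), `E × Y`, THE HODGE CONJECTURE FOR `Y × E`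
and for everything isogenous to it, and the printed instance **Thm. 0.2 (3), case (g) with `End⁰(X₂) = k`**
(`isDivisorGenerated_of_isIsogenous_cmCurve_prod_fourfold_caseG`: `X ∼ X₁ × X₂`, `X₁` an elliptic curve of CM type, `X₂`
a fourfold with `dim_ℚ End⁰(X₂) = 2`, `φ ≫ φ = -d`, multiplicity `1` at `± i√d` ⟹ `B•(X) = D•(X)` and HC for `X`);
finally, for `Y` SIMPLE, **`B•(Y × E) = D•(Y × E)` and HC for everything isogenous to `Y × E` for EVERY elliptic curve
`E`** (`isDivisorGenerated_prod_curve_of_isSimple_unitaryTypeOne`,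
`hodgeConjectureFor_of_isIsogenous_prod_curve_of_isSimple_unitaryTypeOne`: `E` not of CM type by the tree's
`TimesNonCMCurveProductSpan`, Lemma (3.4); `E` of CM type by §5).

SCOPE (numbers, not adjectives). Proved: all `dim Y ≥ 4` with multiplicities `(dim Y − 1, 1)` and `End⁰(Y)`
two-dimensional; `E` any elliptic curve carrying `χ ≫ χ = -d'`, in particular `ℚ(χ) ≅ ℚ(φ)` (the resonant case (g);
for `ℚ(χ) ≇ ℚ(φ)` the results are also the tree's R24, all slots). Printed instance: `dim Y = 4` (`X` a fivefold).
NOT covered: case (g) with `End⁰(X₂) ⊋ k` (a CM field of degree `4` or `8` containing `k`; `TODO(general form)`), the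
second sentence of Thm. 0.2 (3) («`Hg(X)` is strictly contained in `Sp_D(V,φ)`»), and more than ONE slot over `E`:
for `E² × Y` with `dim Y = 4` the Weil classes `W_k ⊂ H⁶(E² × Y, ℚ)` are Hodge classes (loc. cit. (5.11)) and the
`Y`-kind-balance conclusion of §3 is false — nothing is asserted there.

## References

* [MoonenZarhin1999LowDim] B. Moonen, Yu. Zarhin, Math. Ann. 315 (1999), Thm. 0.2 (3) with case (g), §2 (2.3),
  §3 (3.1), §5 (5.11) Case 2, (5.12) (held `paper:arxiv-math_9901113` chunks p0001–p0002, p0005–p0006, p0010–p0011).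
  [cite: MoonenZarhin1999LowDim, Thm. 0.2 (3) and §5 (5.11)–(5.12)]
* [Deligne1982HodgeCycles] P. Deligne, *Hodge cycles on abelian varieties*, LNM 900 (1982), I §3 Prop. 3.4
  (the Hodge group fixes exactly the Hodge classes). [cite: Deligne1982HodgeCycles, I §3 Prop. 3.4]
* [Lombardo2016] D. Lombardo, Ann. Inst. Fourier 66 (2016), Lemma 3.4 (p. 1229). [cite: Lombardo2016, Lemma 3.4 (p. 1229)]
* [Ribet1983] K. Ribet, *Hodge classes on certain types of abelian varieties*, Amer. J. Math. 105 (1983), Thm. 3.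
  [cite: Ribet1983, Thm. 3]
* [GoodmanWallachGTM255] R. Goodman, N. Wallach, GTM 255, §4.1.1 (weights of the diagonal torus on tensor words).
  [cite: GoodmanWallachGTM255, §4.1.1]
* [SilvermanAEC2009] J. H. Silverman, GTM 106 (2nd ed., 2009), III.9 Cor. 9.4 (`End(E) = ℤ` or an order in an imaginary quadratic field). [cite: SilvermanAEC2009, III.9 Cor. 9.4]
* [Greub1978Multilinear] W. Greub, *Multilinear Algebra* (2nd ed., 1978), §4.2 (4.2). [cite: Greub1978Multilinear, §4.2 (4.2)]
* [vanGeemen1994HodgeAV] B. van Geemen, LNM 1594 (1994), §2.4–2.5, §3.6 (p. 236), Lemma 3.7.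
  [cite: vanGeemen1994HodgeAV, §3.6 (p. 236) and Lemma 3.7]
-/

noncomputable section

open scoped TensorProduct
open CategoryTheory Module

namespace Literature.AlgebraicGeometry.HodgeTheory

open Literature.AlgebraicTopology.SingularHomology
open Literature.AlgebraicGeometry.Motives (IsSmoothProjective AbelianVariety bettiCohomology
  ofRatClassBaseChange ofRatClassBaseChange_tmul HodgeTensorFacts hodgeTensorFacts_holds ComplexPoints)
open Literature.Barriers.HodgeConjecture
open Literature.AlgebraicGeometry.Motives.HodgeStructure
open Literature.AlgebraicGeometry.ComplexMultiplication
open Literature.RepresentationTheory.GeneralLinear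
open Literature.NumberTheory.DiophantineGeometry

/-! ### §1 Word combinatorics of the torus `{r·a + tr_k B = 0}`: root-difference weights, `Θ`-balance and ONE slot force `Y`-kind balance -/

section Combinatorics

variable {hY h d : ℕ}

/-- `∑_t (±1 by kind) = #(kind 0) - #(kind 1)` over any finset of positions. [folklore] -/
private theorem sum_kindSign_eq_card_sub_card (s : Finset (Fin d)) (η : Fin d → Fin 2) :
    ∑ t ∈ s, (if η t = 0 then (1 : ℤ) else -1) =
      ((s.filter fun t => η t = 0).card : ℤ) - ((s.filter fun t => η t = 1).card : ℤ) := by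
  rw [Finset.card_filter, Finset.card_filter, Nat.cast_sum, Nat.cast_sum, ← Finset.sum_sub_distrib]
  refine Finset.sum_congr rfl fun t _ => ?_
  rcases Fin.exists_fin_two.1 ⟨η t, rfl⟩ with h0 | h1
  · simp [h0]
  · simp [h1]

/-- **The word-combinatorial core** (the weights of the torus `Lie {(u₁, u₂) ∣ u₁^r · det_k(u₂) = 1}` on ONE copy of
`H¹(Y) ⊕ H¹(E)`; Moonen–Zarhin §5 (5.12), last paragraph: «an element `(-1, 1) ∈ Hg(X)` … acts on `H¹(X₁) ⊗ H³(X₂)` as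
`-1`», here in the form valid for every `m ≥ 3`). Places `Fin hY ⊕ Fin h` (pair index on the `Y`-side, pair index on
the `E`-side, `h ≤ 1`), kinds `κ` of the `Y`-pairs (`κ ℓ = 0`: the `W`-member of the pair `ℓ` is of type `(1,0)`) with
`#{κ = 0} ≥ #{κ = 1} + 2`, and a word `t ↦ (P t, η t)` WITHOUT REPEATED LETTERS. If the word is `Θ`-balanced
(`∑_t ±1 = 0`) and killed by every root-difference weight `E_ii - E_jj` of `𝔰𝔩(W)` (`W`-sign `+1` iff `η t = κ ℓ`), then
its `Y`-kind weight vanishes. Proof: the `E_ii - E_jj` give a common value `c` of the signed contents `c_ℓ`; the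
`Y`-kind weight is `c · (#{κ=0} - #{κ=1})`, the `E`-kind weight has absolute value `≤ h ≤ 1`, and the two add up to `0`.
[cite: MoonenZarhin1999LowDim, §5 (5.11) Case 2 and (5.12)] [cite: GoodmanWallachGTM255, §4.1.1] -/
theorem sum_kindSign_inl_eq_zero_of_rootDiffWeights (κ : Fin hY → Fin 2) (P : Fin d → Fin hY ⊕ Fin h)
    (η : Fin d → Fin 2) (hinj : Function.Injective fun t => (P t, η t)) (hh : h ≤ 1)
    (hκ : (Finset.univ.filter fun ℓ => κ ℓ = 1).card + 2 ≤ (Finset.univ.filter fun ℓ => κ ℓ = 0).card)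
    (hΘ : ∑ t, (if η t = 0 then (1 : ℤ) else -1) = 0)
    (hD : ∀ i j : Fin hY, ∑ t, Sum.elim (fun ℓ => (if η t = κ ℓ then (1 : ℤ) else -1) *
        ((if ℓ = i then (1 : ℤ) else 0) - (if ℓ = j then (1 : ℤ) else 0))) (fun _ => (0 : ℤ)) (P t) = 0) :
    ∑ t, Sum.elim (fun _ => if η t = 0 then (1 : ℤ) else -1) (fun _ => (0 : ℤ)) (P t) = 0 := by
  classical
  -- the signed content `c ℓ` of the pair `ℓ`
  set c : Fin hY → ℤ := fun ℓ => ∑ t, Sum.elim (fun ℓ' => if ℓ' = ℓ then (if η t = κ ℓ' then (1 : ℤ) else -1) else 0)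
    (fun _ => (0 : ℤ)) (P t) with hc
  -- (1) `c i = c j`
  have hcc : ∀ i j, c i = c j := by
    intro i j
    have h := hD i j
    have hsplit : ∀ t, Sum.elim (fun ℓ => (if η t = κ ℓ then (1 : ℤ) else -1) *
        ((if ℓ = i then (1 : ℤ) else 0) - (if ℓ = j then (1 : ℤ) else 0))) (fun _ => (0 : ℤ)) (P t) =
        Sum.elim (fun ℓ' => if ℓ' = i then (if η t = κ ℓ' then (1 : ℤ) else -1) else 0) (fun _ => (0 : ℤ)) (P t) -
        Sum.elim (fun ℓ' => if ℓ' = j then (if η t = κ ℓ' then (1 : ℤ) else -1) else 0) (fun _ => (0 : ℤ)) (P t) := by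
      intro t
      rcases P t with ℓ | e
      · simp only [Sum.elim_inl]
        split_ifs <;> ring
      · simp
    simp only [hsplit, Finset.sum_sub_distrib] at h
    exact sub_eq_zero.1 h
  -- (2) the `Y`-kind weight is `∑_ℓ sgn(κ ℓ) · c ℓ`
  have hKW : ∑ t, Sum.elim (fun _ => if η t = 0 then (1 : ℤ) else -1) (fun _ => (0 : ℤ)) (P t) =
      ∑ ℓ, (if κ ℓ = 0 then (1 : ℤ) else -1) * c ℓ := by
    have hpt : ∀ t, Sum.elim (fun _ => if η t = 0 then (1 : ℤ) else -1) (fun _ => (0 : ℤ)) (P t) =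
        ∑ ℓ, (if κ ℓ = 0 then (1 : ℤ) else -1) *
          Sum.elim (fun ℓ' => if ℓ' = ℓ then (if η t = κ ℓ' then (1 : ℤ) else -1) else 0) (fun _ => (0 : ℤ)) (P t) := by
      intro t
      rcases P t with ℓ₀ | e
      · simp only [Sum.elim_inl, mul_ite, mul_zero, Finset.sum_ite_eq, Finset.mem_univ, if_true]
        rcases Fin.exists_fin_two.1 ⟨η t, rfl⟩ with h0 | h0 <;>
          rcases Fin.exists_fin_two.1 ⟨κ ℓ₀, rfl⟩ with k0 | k0 <;> simp [h0, k0]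
      · simp
    simp only [hpt]
    rw [Finset.sum_comm]
    refine Finset.sum_congr rfl fun ℓ _ => ?_
    rw [← Finset.mul_sum]
  -- (3) the `E`-kind weight `uE` and `Θ`-balance: `KW + uE = 0`
  set uE : ℤ := ∑ t, Sum.elim (fun _ => (0 : ℤ)) (fun _ => if η t = 0 then (1 : ℤ) else -1) (P t) with huE
  have hsumΘ : ∑ t, Sum.elim (fun _ => if η t = 0 then (1 : ℤ) else -1) (fun _ => (0 : ℤ)) (P t) + uE = 0 := by
    have e : ∑ t, (Sum.elim (fun _ => if η t = 0 then (1 : ℤ) else -1) (fun _ => (0 : ℤ)) (P t) +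
        Sum.elim (fun _ => (0 : ℤ)) (fun _ => if η t = 0 then (1 : ℤ) else -1) (P t)) =
        ∑ t, (if η t = 0 then (1 : ℤ) else -1) :=
      Finset.sum_congr rfl fun t _ => by rcases P t with ℓ | e <;> simp
    rw [huE, ← Finset.sum_add_distrib, e]
    exact hΘ
  -- (4) `|uE| ≤ 1`: at most `h ≤ 1` `E`-letters of each kind (no repeated letters)
  have hcount : ∀ r : Fin 2, ((Finset.univ.filter fun t => (∃ e, P t = Sum.inr e) ∧ η t = r).card : ℤ) ≤ 1 := by
    intro r
    have hle : (Finset.univ.filter fun t => (∃ e, P t = Sum.inr e) ∧ η t = r).card ≤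
        ((Finset.univ : Finset (Fin h)).map ⟨(Sum.inr : Fin h → Fin hY ⊕ Fin h), Sum.inr_injective⟩).card := by
      refine Finset.card_le_card_of_injOn P (fun t ht => ?_) (fun t ht t' ht' hPP => ?_)
      · obtain ⟨⟨e, he⟩, -⟩ := (Finset.mem_filter.1 ht).2
        simp [he]
      · have hr := (Finset.mem_filter.1 (Finset.mem_coe.1 ht)).2.2
        have hr' := (Finset.mem_filter.1 (Finset.mem_coe.1 ht')).2.2
        exact hinj (Prod.ext hPP (hr.trans hr'.symm))
    rw [Finset.card_map, Finset.card_univ, Fintype.card_fin] at hle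
    omega
  have huE_eq : uE = ((Finset.univ.filter fun t => (∃ e, P t = Sum.inr e) ∧ η t = 0).card : ℤ) -
      ((Finset.univ.filter fun t => (∃ e, P t = Sum.inr e) ∧ η t = 1).card : ℤ) := by
    rw [huE, Finset.card_filter, Finset.card_filter, Nat.cast_sum, Nat.cast_sum, ← Finset.sum_sub_distrib]
    refine Finset.sum_congr rfl fun t _ => ?_
    rcases hP : P t with ℓ | e
    · simp
    · rcases Fin.exists_fin_two.1 ⟨η t, rfl⟩ with h0 | h1
      · simp [h0]
      · simp [h1]
  have huE_le : uE ≤ 1 := by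
    have h0 := hcount 0
    have h1 : (0 : ℤ) ≤ ((Finset.univ.filter fun t => (∃ e, P t = Sum.inr e) ∧ η t = 1).card : ℤ) := Nat.cast_nonneg _
    omega
  have huE_ge : -1 ≤ uE := by
    have h1 := hcount 1
    have h0 : (0 : ℤ) ≤ ((Finset.univ.filter fun t => (∃ e, P t = Sum.inr e) ∧ η t = 0).card : ℤ) := Nat.cast_nonneg _
    omega
  -- (5) `∑_ℓ sgn(κ ℓ) = #{κ=0} - #{κ=1} ≥ 2`, and conclusion
  have hsgn : ∑ ℓ, (if κ ℓ = 0 then (1 : ℤ) else -1) =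
      ((Finset.univ.filter fun ℓ => κ ℓ = 0).card : ℤ) - ((Finset.univ.filter fun ℓ => κ ℓ = 1).card : ℤ) :=
    sum_kindSign_eq_card_sub_card Finset.univ κ
  rcases isEmpty_or_nonempty (Fin hY) with hemp | ⟨⟨ℓ₀⟩⟩
  · simp only [Finset.univ_eq_empty, Finset.filter_empty, Finset.card_empty, zero_add] at hκ
    exact absurd hκ (by norm_num)
  · have hconst : ∀ ℓ, c ℓ = c ℓ₀ := fun ℓ => hcc ℓ ℓ₀
    have hKW' : ∑ t, Sum.elim (fun _ => if η t = 0 then (1 : ℤ) else -1) (fun _ => (0 : ℤ)) (P t) =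
        c ℓ₀ * (((Finset.univ.filter fun ℓ => κ ℓ = 0).card : ℤ) - ((Finset.univ.filter fun ℓ => κ ℓ = 1).card : ℤ)) := by
      rw [hKW, ← hsgn, Finset.mul_sum]
      refine Finset.sum_congr rfl fun ℓ _ => ?_
      rw [hconst ℓ, mul_comm]
    rw [hKW'] at hsumΘ ⊢
    set D : ℤ := ((Finset.univ.filter fun ℓ => κ ℓ = 0).card : ℤ) - ((Finset.univ.filter fun ℓ => κ ℓ = 1).card : ℤ)
      with hDdef
    have hD2 : 2 ≤ D := by rw [hDdef]; omega
    rcases lt_trichotomy (c ℓ₀) 0 with hneg | hzero | hpos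
    · nlinarith
    · rw [hzero, zero_mul]
    · nlinarith

end Combinatorics

/-! ### §2 Antisymmetry survives the refinement to slot-and-place colours -/

section Antisymm

variable {K J T : Type*} [CommRing K] {N d : ℕ}

/-- The refinement `placeRefine φ a` of an antisymmetric coefficient function is antisymmetric (it is `a` composed with
a relabelling of the letters). [cite: Greub1978Multilinear, §4.2 (4.2)] -/
theorem _root_.Literature.RepresentationTheory.GeneralLinear.IsAntisymm.placeRefine (φ : Fin N ≃ T × Fin 2) {a : (Fin d → J × Fin N) → K} (ha : IsAntisymm a) :
    IsAntisymm (placeRefine φ a) := fun σ w =>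
  ha σ (fun t => ((w t).1.1, φ.symm ((w t).1.2, (w t).2)))

end Antisymm

/-! ### §3 The invariance theorem for ONE slot over `Y × E` -/

section Invariance

variable {Y E X : AbelianVariety ℂ} {g : Fin 1 → (X ⟶ Y.prod E)}

/-- The two elements of `Fin 2`. [folklore] -/
private theorem fin2_eq_zero_or_one_u (r : Fin 2) : r = 0 ∨ r = 1 := by
  fin_cases r <;> simp

/-- `(i√d)² = -d` (as the rational `d` cast to `ℂ`). [folklore] -/
private theorem I_mul_sqrt_sq_u (d : ℕ) : (Complex.I * (Real.sqrt d : ℂ)) ^ 2 = -((d : ℚ) : ℂ) := by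
  rw [mul_pow, Complex.I_sq, ← Complex.ofReal_pow, Real.sq_sqrt (Nat.cast_nonneg d), Complex.ofReal_natCast,
    Rat.cast_natCast, neg_one_mul]

/-- `conj(i√d) = -i√d`. [folklore] -/
private theorem conj_I_mul_sqrt_u (d : ℕ) :
    starRingEnd ℂ (Complex.I * (Real.sqrt d : ℂ)) = -(Complex.I * (Real.sqrt d : ℂ)) := by
  rw [map_mul, Complex.conj_I, Complex.conj_ofReal, neg_mul]

/-- `[a]·x - [b]·x = ([a] - [b]) • x` with an integer scalar. [folklore] -/
private theorem ite_sub_ite_eq_cast_smul_u {M : Type*} [AddCommGroup M] [Module ℂ M] (a b : Prop) [Decidable a]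
    [Decidable b] (x : M) :
    ((if a then x else 0) - (if b then x else 0)) =
      ((((if a then (1 : ℤ) else 0) - (if b then (1 : ℤ) else 0) : ℤ)) : ℂ) • x := by
  split_ifs <;> simp

set_option maxHeartbeats 800000 in
open scoped Classical in
/-- **The INVARIANCE THEOREM for ONE slot over `Y × E`, `Y` of unitary type `(dim Y − 1, 1)` with `dim Y ≥ 4`, `E` ANY
elliptic curve with complex multiplication** (Moonen–Zarhin 1999 §5 (5.11) Case 2 / Thm. 0.2 (3) case (g): «`Hg(X) =
{(u₁,u₂) ∈ U_k × U_F(V_Y,ψ) ∣ u₁² · det_k(u₂) = 1}` … an element `(-1, 1) ∈ Hg(X)` which acts on `H¹(X₁) ⊗ H³(X₂)` as `-1`.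
This shows there are no Hodge classes in `H¹(X₁) ⊗ H³(X₂)` and that `B•(X)` is generated by divisor classes»; Lie step
`Motives/HodgeThetaAnnihilatorUnitaryTimesCMCurve`). Let `Y` be a complex abelian variety of dimension `≥ 4` with
`dim_ℚ End⁰(Y) = 2`, `φ ≫ φ = -d` (`d > 0`) and multiplicity `1` at `i√d` or at `-i√d` (`End⁰(Y) = k'` imaginary quadratic
acting with multiplicities `(dim Y − 1, 1)`), `E` an elliptic curve with `χ ≫ χ = -d'` (`d' > 0`; NO condition relating
`d` and `d'`), and `X` an abelian variety with ONE slot over `Y × E` (e.g. `X = Y × E`). Then there are Hodge-adapted pair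
bases of `H¹(Y) ⊗ ℂ` and `H¹(E) ⊗ ℂ` such that every rational `(p,p)`-class on `X` has a letter expansion whose
coefficient function VANISHES off the `Y`-kind-balanced words — the conclusion of the tree's
`AVSlots.exists_coeff_eq_zero_off_balanced_of_prod_quadraticEnd_cmCurve` (there: `d ≠ q²d'`, any number of slots), so
the typed-Künneth pipeline applies verbatim. Proof: the antisymmetric kind-balanced coefficient function of the class
is killed by `Θ` and (Lie step + THEOREM L′) by `ι_Y [Y₁, Y₂] π_Y` for all `Y₁, Y₂ ∈ 𝔲_{k'}(H¹Y, ψ)_ℂ`, in particular by the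
root differences `E_ii - E_jj` of `𝔰𝔩(W)` in an adapted `ψ_ℂ`-dual basis; on a word without repeated letters over ONE
copy of `H¹(Y) ⊕ H¹(E)` these weights and `dim(W ∩ H^{1,0}) - dim(W ∩ H^{0,1}) = dim Y - 2 ≥ 2 > 1 ≥ |E-kind weight|`
force `Y`-kind balance (`sum_kindSign_inl_eq_zero_of_rootDiffWeights`). For TWO or more slots the conclusion fails
when `dim Y = 4` (Weil classes on `E² × Y`, loc. cit.: «`W_k ⊂ H⁶(Z,ℚ)` consists of Hodge classes»).
[cite: MoonenZarhin1999LowDim, §5 (5.11) Case 2 and (5.12)] [cite: MoonenZarhin1999LowDim, §2 (2.3) and §3 (3.1)]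
[cite: Deligne1982HodgeCycles, I §3 Prop. 3.4] [cite: Lombardo2016, Lemma 3.4 (p. 1229)] [cite: Ribet1983, Thm. 3] -/
theorem AVSlots.exists_coeff_eq_zero_off_balanced_of_prod_unitaryTypeOne_cmCurve (hg : AVSlots (Y.prod E) X g)
    (hY4 : 4 ≤ Y.dim) (hY2 : Module.finrank ℚ Y.endAlgebra = 2) (φY : Y ⟶ Y) {d : ℕ} (hd : 0 < d)
    (hφY : φY ≫ φY = -(d • 𝟙 Y))
    (hm1 : eigenMultiplicity Y φY (Complex.I * (Real.sqrt d : ℂ)) = 1 ∨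
      eigenMultiplicity Y φY (-(Complex.I * (Real.sqrt d : ℂ))) = 1)
    (hE1 : E.dim = 1) (χ : E ⟶ E) {d' : ℕ} (hd' : 0 < d') (hχ : χ ≫ χ = -(d' • 𝟙 E)) :
    ∃ (hA : ℕ) (bA : Module.Basis (Fin hA × Fin 2) ℂ (ℂ ⊗[ℚ] bettiCohomology Y.X 1))
      (h : ℕ) (cC : Module.Basis (Fin h × Fin 2) ℂ (ℂ ⊗[ℚ] bettiCohomology E.X 1)),
      (∀ i, IsOfHodgeType Y.dim Y.X 1 1 0 (ofRatClassBaseChange (Motives.ComplexPoints Y.X) 1 (bA (i, 0)))) ∧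
      (∀ i, IsOfHodgeType Y.dim Y.X 1 0 1 (ofRatClassBaseChange (Motives.ComplexPoints Y.X) 1 (bA (i, 1)))) ∧
      (∀ i, IsOfHodgeType E.dim E.X 1 1 0 (ofRatClassBaseChange (Motives.ComplexPoints E.X) 1 (cC (i, 0)))) ∧
      (∀ i, IsOfHodgeType E.dim E.X 1 0 1 (ofRatClassBaseChange (Motives.ComplexPoints E.X) 1 (cC (i, 1)))) ∧
      ∀ {p : ℕ}, 0 < p → ∀ {c : complexBetti X.X (2 * p)}, IsRationalClass c →
        IsOfHodgeType X.dim X.X (2 * p) p p c →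
        ∃ a : (Fin (2 * p) → (Fin 1 × (Fin hA ⊕ Fin h)) × Fin 2) → ℂ,
          wordEval (cupPowOneAlt ℂ (Motives.ComplexPoints X.X) (2 * p))
            (fun jr : (Fin 1 × (Fin hA ⊕ Fin h)) × Fin 2 => complexBetti.map (g jr.1.1).hom.hom.hom 1
              (Sum.elim
                (fun i => complexBetti.map (Motives.AbelianVariety.fst Y E).hom.hom.hom 1
                  (ofRatClassBaseChange (Motives.ComplexPoints Y.X) 1 (bA (i, jr.2))))
                (fun i => complexBetti.map (Motives.AbelianVariety.snd Y E).hom.hom.hom 1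
                  (ofRatClassBaseChange (Motives.ComplexPoints E.X) 1 (cC (i, jr.2))))
                jr.1.2)) a = c ∧
          ∀ (U : Fin (2 * p) → Fin 1 × (Fin hA ⊕ Fin h)) (η : Fin (2 * p) → Fin 2),
            (∑ t, Sum.elim (fun _ : Fin hA => if η t = 0 then (1 : ℂ) else -1) (fun _ : Fin h => (0 : ℂ)) (U t).2) ≠ 0 →
            a (fun t => (U t, η t)) = 0 := by
  classical
  -- the setting
  have hHD : exists_isReal_hodgeModel := exists_isReal_hodgeModel_holds
  have hI : hodgePQ_independent_of_hodgeModel := hodgePQ_independent_of_hodgeModel_holds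
  haveI : HodgeTensorFacts.{0, 0} := hodgeTensorFacts_holds.{0, 0}
  have hXA : IsSmoothProjective Y.dim Y.X := AbelianVariety.isSmoothProjective_holds
  have hXC : IsSmoothProjective E.dim E.X := AbelianVariety.isSmoothProjective_holds
  have hXP : IsSmoothProjective (Y.prod E).dim (Y.prod E).X := AbelianVariety.isSmoothProjective_holds
  haveI : Module.Finite ℚ (bettiCohomology Y.X 1) := finite_bettiCohomology_one Y
  haveI : Module.Finite ℚ (bettiCohomology E.X 1) := finite_bettiCohomology_one E
  haveI : Module.Finite ℚ (bettiCohomology (Y.prod E).X 1) := finite_bettiCohomology_one (Y.prod E)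
  have hn1 : (((1 : ℕ) : ℤ)) = 1 := by norm_num
  have heffA := BettiUniverse.hodge_isEffective hHD hXA 1
  -- polarizations of `H¹(Y)`, `H¹(E)`
  obtain ⟨ψ⟩ : (BettiUniverse.hodge hHD (AbelianVariety.isSmoothProjective_holds (A := Y)) 1).IsPolarizable :=
    smoothProjective_hodgeStructure_isPolarizable_holds hXA (BettiUniverse.realHodgeModel hHD hXA)
      (BettiUniverse.realHodgeModel_isHodgeSymmetric hHD hXA) 1
  obtain ⟨ψC⟩ : (BettiUniverse.hodge hHD (AbelianVariety.isSmoothProjective_holds (A := E)) 1).IsPolarizable :=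
    smoothProjective_hodgeStructure_isPolarizable_holds hXC (BettiUniverse.realHodgeModel hHD hXC)
      (BettiUniverse.realHodgeModel_isHodgeSymmetric hHD hXC) 1
  -- the unitary data of `H¹(Y)`: `φ^*`, `End_Hdg = ℚ + ℚφ^*`, `μ` with `n''(μ) = 1`, `n'(μ) ≥ 2`
  set φQ : Module.End ℚ (bettiCohomology Y.X 1) := (bettiCohomology.map φY.hom.hom.hom 1).hom with hφQ
  have hφE : φQ ∈ (BettiUniverse.hodge hHD (AbelianVariety.isSmoothProjective_holds (A := Y)) 1).endAlg :=
    pullback_mem_endAlg hHD hI φY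
  have hφ2 : φQ * φQ = -((d : ℚ) • 1) := bettiMapHom_mul_self hφY
  have hdQ : (0 : ℚ) < d := Nat.cast_pos.2 hd
  have hE := exists_eq_smul_one_add_smul_bettiMapHom hHD hI hd hφY hY2 (by omega)
  have hsumm := eigenMultiplicity_add_eigenMultiplicity_neg_eq_dim Y φY hd hφY
  obtain ⟨μ, hμ, hmult1, hmult2⟩ : ∃ μ : ℂ, μ ^ 2 = -((d : ℚ) : ℂ) ∧
      eigenMultiplicity Y φY (starRingEnd ℂ μ) = 1 ∧ 2 ≤ eigenMultiplicity Y φY μ := by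
    rcases hm1 with h | h
    · exact ⟨-(Complex.I * (Real.sqrt d : ℂ)), by rw [neg_sq, I_mul_sqrt_sq_u],
        by rw [map_neg, conj_I_mul_sqrt_u, neg_neg, h], by omega⟩
    · exact ⟨Complex.I * (Real.sqrt d : ℂ), I_mul_sqrt_sq_u d, by rw [conj_I_mul_sqrt_u, h], by omega⟩
  have h1' : Module.finrank ℂ ↥(Module.End.eigenspace (φQ.baseChange ℂ) μ ⊓
      (BettiUniverse.hodge hHD (AbelianVariety.isSmoothProjective_holds (A := Y)) 1).piece 0 1) = 1 := by
    rw [hφQ, finrank_eigenspace_inf_piece_zeroOne_eq_eigenMultiplicity_conj hHD hI φY μ, hmult1]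
  have h2' : 2 ≤ Module.finrank ℂ ↥(Module.End.eigenspace (φQ.baseChange ℂ) μ ⊓
      (BettiUniverse.hodge hHD (AbelianVariety.isSmoothProjective_holds (A := Y)) 1).piece 1 0) := by
    rw [hφQ, finrank_eigenspace_inf_piece_oneZero_eq_eigenMultiplicity hHD hI φY μ]
    exact hmult2
  obtain ⟨hμ0, -⟩ := UnitaryTheta.conj_eq_neg_of_sq hdQ hμ
  -- adapted `ψ_ℂ`-dual bases `(e_ℓ, f_ℓ) = (cb (0,ℓ), cb (1,ℓ))` of `H¹(Y) ⊗ ℂ = W ⊕ W'`, kinds `κ`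
  obtain ⟨n₀, cb, κ, hcbW, hcbW', hcb0, hcb1, hdual⟩ := UnitaryTheta.exists_adaptedDualBasis
    (BettiUniverse.hodge hHD (AbelianVariety.isSmoothProjective_holds (A := Y)) 1) Nat.cast_one heffA ψ hφE
    hdQ hφ2 hE hμ
  -- the same basis in PAIR format: `bY (ℓ, r) = cb (if r = κ ℓ then 0 else 1, ℓ)` (`r` = the Hodge kind)
  set τ : Fin n₀ × Fin 2 ≃ Fin 2 × Fin n₀ :=
    { toFun := fun lr => (if lr.2 = κ lr.1 then 0 else 1, lr.1)
      invFun := fun tl => (tl.2, if tl.1 = 0 then κ tl.2 else (if κ tl.2 = 0 then 1 else 0))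
      left_inv := by
        rintro ⟨ℓ, r⟩
        rcases fin2_eq_zero_or_one_u r with hr | hr <;>
          rcases fin2_eq_zero_or_one_u (κ ℓ) with hk | hk <;> simp [hr, hk]
      right_inv := by
        rintro ⟨t, ℓ⟩
        rcases fin2_eq_zero_or_one_u t with ht | ht <;>
          rcases fin2_eq_zero_or_one_u (κ ℓ) with hk | hk <;> simp [ht, hk] } with hτ
  set bY : Module.Basis (Fin n₀ × Fin 2) ℂ (ℂ ⊗[ℚ] bettiCohomology Y.X 1) := cb.reindex τ.symm with hbYdef
  have hbY : ∀ ℓ r, bY (ℓ, r) = cb (if r = κ ℓ then 0 else 1, ℓ) := fun ℓ r => by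
    rw [hbYdef, Module.Basis.reindex_apply, Equiv.symm_symm]
    rfl
  have hbY0' : ∀ ℓ, bY (ℓ, 0) ∈ (BettiUniverse.hodge hHD hXA 1).piece 1 0 := by
    intro ℓ
    rw [hbY]
    rcases fin2_eq_zero_or_one_u (κ ℓ) with hk | hk
    · rw [hk, if_pos rfl]; exact (hcb0 ℓ hk).1
    · rw [hk, if_neg (by decide)]; exact (hcb1 ℓ hk).2
  have hbY1' : ∀ ℓ, bY (ℓ, 1) ∈ (BettiUniverse.hodge hHD hXA 1).piece 0 1 := by
    intro ℓ
    rw [hbY]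
    rcases fin2_eq_zero_or_one_u (κ ℓ) with hk | hk
    · rw [hk, if_neg (by decide)]; exact (hcb0 ℓ hk).2
    · rw [hk, if_pos rfl]; exact (hcb1 ℓ hk).1
  -- the pair basis of `H¹(E) ⊗ ℂ`
  obtain ⟨h, cC, hcC0, hcC1⟩ := exists_hodgeAdapted_pairBasis (BettiUniverse.hodge hHD hXC 1) (by norm_num)
    (BettiUniverse.hodge_isEffective hHD hXC 1)
  have hcC0' : ∀ i, cC (i, 0) ∈ (BettiUniverse.hodge hHD hXC 1).piece 1 0 := fun i => by simpa using hcC0 i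
  have hcC1' : ∀ i, cC (i, 1) ∈ (BettiUniverse.hodge hHD hXC 1).piece 0 1 := fun i => by simpa using hcC1 i
  refine ⟨n₀, bY, h, cC, fun i => ?_, fun i => ?_, fun i => ?_, fun i => ?_, ?_⟩
  · exact (BettiUniverse.mem_hodge_piece_iff hHD hI hXA (k := 1) (p := 1) (q := 0) rfl _).1 (hbY0' i)
  · exact (BettiUniverse.mem_hodge_piece_iff hHD hI hXA (k := 1) (p := 0) (q := 1) rfl _).1 (hbY1' i)
  · exact (BettiUniverse.mem_hodge_piece_iff hHD hI hXC (k := 1) (p := 1) (q := 0) rfl _).1 (hcC0' i)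
  · exact (BettiUniverse.mem_hodge_piece_iff hHD hI hXC (k := 1) (p := 0) (q := 1) rfl _).1 (hcC1' i)
  intro p hp c hcQ hc
  -- COUNTS: `h = 1` (`dim E = 1`), `n₀ = dim Y`, `#{κ = 1} ≤ 1` (`n''(μ) = 1`), hence `#{κ = 1} + 2 ≤ #{κ = 0}`
  have hh1 : h = 1 := by
    have hcard := Module.finrank_eq_card_basis cC
    rw [Module.finrank_baseChange, finrank_bettiCohomology_one E, hE1, Fintype.card_prod, Fintype.card_fin,
      Fintype.card_fin] at hcard
    omega
  have hn₀ : n₀ = Y.dim := by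
    have hcard := Module.finrank_eq_card_basis cb
    rw [Module.finrank_baseChange, finrank_bettiCohomology_one Y, Fintype.card_prod, Fintype.card_fin,
      Fintype.card_fin] at hcard
    omega
  have hκ1 : (Finset.univ.filter fun ℓ => κ ℓ = 1).card ≤ 1 := by
    set S := Module.End.eigenspace (φQ.baseChange ℂ) μ ⊓
      (BettiUniverse.hodge hHD (AbelianVariety.isSmoothProjective_holds (A := Y)) 1).piece 0 1 with hS
    set f : {ℓ : Fin n₀ // κ ℓ = 1} → ↥S := fun ℓ => ⟨cb (0, ℓ.1), hcbW ℓ.1, (hcb1 ℓ.1 ℓ.2).1⟩ with hf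
    have hli : LinearIndependent ℂ f := by
      refine LinearIndependent.of_comp S.subtype ?_
      have hcomp : ⇑S.subtype ∘ f = ⇑cb ∘ fun ℓ : {ℓ : Fin n₀ // κ ℓ = 1} => ((0 : Fin 2), ℓ.1) := by
        funext ℓ; rfl
      rw [hcomp]
      exact cb.linearIndependent.comp _ fun ℓ ℓ' hll => Subtype.ext (Prod.mk.inj hll).2
    have hle := hli.fintype_card_le_finrank
    rw [Fintype.card_subtype, h1'] at hle
    exact hle
  have hκsum : (Finset.univ.filter fun ℓ => κ ℓ = 0).card + (Finset.univ.filter fun ℓ => κ ℓ = 1).card = n₀ := by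
    have hneg : (Finset.univ.filter fun ℓ => ¬ κ ℓ = 0) = (Finset.univ.filter fun ℓ => κ ℓ = 1) := by
      refine Finset.filter_congr fun ℓ _ => ?_
      rcases fin2_eq_zero_or_one_u (κ ℓ) with hk | hk <;> simp [hk]
    rw [← hneg, Finset.card_filter_add_card_filter_not, Finset.card_univ, Fintype.card_fin]
  have hκ : (Finset.univ.filter fun ℓ => κ ℓ = 1).card + 2 ≤ (Finset.univ.filter fun ℓ => κ ℓ = 0).card := by
    omega
  -- the presentation `H¹(Y × E) = pr_Y^* H¹(Y) ⊕ pr_E^* H¹(E)` and its complexification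
  set ι₁ := HOneProduct.pullFst Y E with hι₁
  set π₁ := HOneProduct.pullInl Y E with hπ₁
  set ι₂ := HOneProduct.pullSnd Y E with hι₂
  set π₂ := HOneProduct.pullInr Y E with hπ₂
  have hπι₁ : π₁ ∘ₗ ι₁ = LinearMap.id := HOneProduct.pullInl_comp_pullFst
  have hπι₂ : π₂ ∘ₗ ι₂ = LinearMap.id := HOneProduct.pullInr_comp_pullSnd
  have hπ₁ι₂ : π₁ ∘ₗ ι₂ = 0 := HOneProduct.pullInl_comp_pullSnd
  have hπ₂ι₁ : π₂ ∘ₗ ι₁ = 0 := HOneProduct.pullInr_comp_pullFst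
  have hsum : ι₁ ∘ₗ π₁ + ι₂ ∘ₗ π₂ = LinearMap.id := HOneProduct.pullFst_comp_pullInl_add
  have hπι₁C : π₁.baseChange ℂ ∘ₗ ι₁.baseChange ℂ = LinearMap.id := by
    rw [← LinearMap.baseChange_comp, hπι₁, LinearMap.baseChange_id]
  have hπι₂C : π₂.baseChange ℂ ∘ₗ ι₂.baseChange ℂ = LinearMap.id := by
    rw [← LinearMap.baseChange_comp, hπι₂, LinearMap.baseChange_id]
  have hπ₁ι₂C : π₁.baseChange ℂ ∘ₗ ι₂.baseChange ℂ = 0 := by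
    rw [← LinearMap.baseChange_comp, hπ₁ι₂, LinearMap.baseChange_zero]
  have hπ₂ι₁C : π₂.baseChange ℂ ∘ₗ ι₁.baseChange ℂ = 0 := by
    rw [← LinearMap.baseChange_comp, hπ₂ι₁, LinearMap.baseChange_zero]
  have hsumC : ι₁.baseChange ℂ ∘ₗ π₁.baseChange ℂ + ι₂.baseChange ℂ ∘ₗ π₂.baseChange ℂ = LinearMap.id := by
    rw [← LinearMap.baseChange_comp, ← LinearMap.baseChange_comp, ← LinearMap.baseChange_add, hsum,
      LinearMap.baseChange_id]
  have e11 : ∀ x, π₁.baseChange ℂ (ι₁.baseChange ℂ x) = x := fun x => by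
    rw [← LinearMap.comp_apply (f := π₁.baseChange ℂ), hπι₁C, LinearMap.id_apply]
  have e12 : ∀ y, π₁.baseChange ℂ (ι₂.baseChange ℂ y) = 0 := fun y => by
    rw [← LinearMap.comp_apply (f := π₁.baseChange ℂ), hπ₁ι₂C, LinearMap.zero_apply]
  -- piece compatibility of `pr_Y^*`, `pr_E^*`
  have hι₁F : ∀ q : ℤ, ∀ x ∈ (BettiUniverse.hodge hHD hXA 1).piece q (((1 : ℕ) : ℤ) - q),
      ι₁.baseChange ℂ x ∈ (BettiUniverse.hodge hHD hXP 1).piece q (((1 : ℕ) : ℤ) - q) :=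
    fun q x hx => (BettiUniverse.pullHodgeHom hHD hI hXP hXA (Motives.AbelianVariety.fst Y E).hom.hom.hom 1).map_piece_le
      q _ ⟨x, hx, rfl⟩
  have hι₂F : ∀ q : ℤ, ∀ x ∈ (BettiUniverse.hodge hHD hXC 1).piece q (((1 : ℕ) : ℤ) - q),
      ι₂.baseChange ℂ x ∈ (BettiUniverse.hodge hHD hXP 1).piece q (((1 : ℕ) : ℤ) - q) :=
    fun q x hx => (BettiUniverse.pullHodgeHom hHD hI hXP hXC (Motives.AbelianVariety.snd Y E).hom.hom.hom 1).map_piece_le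
      q _ ⟨x, hx, rfl⟩
  -- the basis `cbx` of `H¹(Y × E) ⊗ ℂ` in pairs: `pr_Y^* bY_ℓ^r` and `pr_E^* c_i^r`
  obtain ⟨cbx', hcbx'l, hcbx'r⟩ := exists_basis_of_presentation hπι₁C hπι₂C hπ₁ι₂C hπ₂ι₁C hsumC bY cC
  set cbx : Module.Basis ((Fin n₀ ⊕ Fin h) × Fin 2) ℂ (ℂ ⊗[ℚ] bettiCohomology (Y.prod E).X 1) :=
    cbx'.reindex (Equiv.sumProdDistrib (Fin n₀) (Fin h) (Fin 2)).symm with hcbxdef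
  have hcbx : ∀ tr : (Fin n₀ ⊕ Fin h) × Fin 2, cbx tr =
      Sum.elim (fun i => ι₁.baseChange ℂ (bY (i, tr.2))) (fun i => ι₂.baseChange ℂ (cC (i, tr.2))) tr.1 := by
    rintro ⟨t, r⟩
    rw [hcbxdef, Module.Basis.reindex_apply, Equiv.symm_symm]
    rcases t with i | i
    · rw [Equiv.sumProdDistrib_apply_left, hcbx'l]; rfl
    · rw [Equiv.sumProdDistrib_apply_right, hcbx'r]; rfl
  -- Hodge-adaptedness of `cbx`
  have hcbx0 : ∀ t, cbx (t, 0) ∈ (BettiUniverse.hodge hHD hXP 1).piece 1 0 := by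
    intro t
    rw [hcbx]
    rcases t with i | i
    · have e : (((1 : ℕ) : ℤ) - 1) = 0 := by norm_num
      have h10 := hι₁F 1 _ (by rw [e]; exact hbY0' i)
      rwa [e] at h10
    · have e : (((1 : ℕ) : ℤ) - 1) = 0 := by norm_num
      have h10 := hι₂F 1 _ (by rw [e]; exact hcC0' i)
      rwa [e] at h10
  have hcbx1 : ∀ t, cbx (t, 1) ∈ (BettiUniverse.hodge hHD hXP 1).piece 0 1 := by
    intro t
    rw [hcbx]
    rcases t with i | i
    · have e : (((1 : ℕ) : ℤ) - 0) = 1 := by norm_num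
      have h01 := hι₁F 0 _ (by rw [e]; exact hbY1' i)
      rwa [e] at h01
    · have e : (((1 : ℕ) : ℤ) - 0) = 1 := by norm_num
      have h01 := hι₂F 0 _ (by rw [e]; exact hcC1' i)
      rwa [e] at h01
  -- bases indexed by `Fin M`: the pair basis `cbσ` and the rational basis `eC`
  set eQ := Module.finBasis ℚ (bettiCohomology (Y.prod E).X 1) with heQ
  set eC : Module.Basis (Fin (Module.finrank ℚ (bettiCohomology (Y.prod E).X 1))) ℂ
    (ℂ ⊗[ℚ] bettiCohomology (Y.prod E).X 1) := Algebra.TensorProduct.basis ℂ eQ with heC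
  set φ : Fin (Module.finrank ℚ (bettiCohomology (Y.prod E).X 1)) ≃ (Fin n₀ ⊕ Fin h) × Fin 2 :=
    eC.indexEquiv cbx with hφ
  set cbσ : Module.Basis (Fin (Module.finrank ℚ (bettiCohomology (Y.prod E).X 1))) ℂ
    (ℂ ⊗[ℚ] bettiCohomology (Y.prod E).X 1) := cbx.reindex φ.symm with hcbσdef
  have hcbσ : ∀ m, cbσ m = cbx (φ m) := fun m => by
    rw [hcbσdef, Module.Basis.reindex_apply, Equiv.symm_symm]
  -- letters
  set ρ := ofRatClassBaseChangeEquiv hXP 1 with hρ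
  set v : Module.Basis _ ℂ (complexBetti (Y.prod E).X 1) := cbσ.map ρ with hv
  set eL : Module.Basis _ ℂ (complexBetti (Y.prod E).X 1) := eC.map ρ with heL
  have heLQ : ∀ i, IsRationalClass (eL i) := fun i => by
    rw [heL, Module.Basis.map_apply, heC, Algebra.TensorProduct.basis_apply, hρ,
      ofRatClassBaseChangeEquiv_apply, ofRatClassBaseChange_tmul, one_smul]
    exact isRationalClass_ofRatClass _
  set κ' : Fin (Module.finrank ℚ (bettiCohomology (Y.prod E).X 1)) → Fin 2 := fun m => (φ m).2 with hκ'
  have hv_apply : ∀ m, v m = ofRatClassBaseChange (Motives.ComplexPoints (Y.prod E).X) 1 (cbx (φ m)) := fun m => by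
    rw [hv, Module.Basis.map_apply, hcbσ, hρ, ofRatClassBaseChangeEquiv_apply]
  have hv0 : ∀ m, κ' m = 0 → IsOfHodgeType (Y.prod E).dim (Y.prod E).X 1 1 0 (v m) := by
    intro m hm
    rw [hv_apply, ← BettiUniverse.mem_hodge_piece_iff hHD hI hXP (k := 1) (p := 1) (q := 0) rfl]
    have hsplit : φ m = ((φ m).1, 0) := by
      change (φ m).2 = 0 at hm; rw [← hm]
    rw [hsplit]
    exact hcbx0 _
  have hv1 : ∀ m, κ' m = 1 → IsOfHodgeType (Y.prod E).dim (Y.prod E).X 1 0 1 (v m) := by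
    intro m hm
    rw [hv_apply, ← BettiUniverse.mem_hodge_piece_iff hHD hI hXP (k := 1) (p := 0) (q := 1) rfl]
    have hsplit : φ m = ((φ m).1, 1) := by
      change (φ m).2 = 1 at hm; rw [← hm]
    rw [hsplit]
    exact hcbx1 _
  -- (α) an antisymmetric kind-balanced coefficient function in the adapted letters
  obtain ⟨ax, hax_bal, hax_anti, hcax⟩ := hg.exists_antisymm_kindBalanced_wordEval_eq v κ' hv0 hv1 hp hc
  -- the change of letters to the rational letters
  set G : Matrix _ _ ℂ := eC.toMatrix cbσ with hG
  set G' : Matrix _ _ ℂ := cbσ.toMatrix eC with hG'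
  have hG'G : G' * G = 1 := cbσ.toMatrix_mul_toMatrix_flip eC
  have hve : ∀ m, v m = ∑ i, G i m • eL i := fun m => by
    simp only [hv, heL, Module.Basis.map_apply, ← map_smul, ← map_sum]
    congr 1
    exact (eC.sum_toMatrix_smul_self (v := ⇑cbσ) (j := m)).symm
  have hletters : ∀ j m, avLetters g v (j, m) = ∑ i, G i m • avLetters g eL (j, i) :=
    avLetters_baseChange g G hve
  set aE := colourChangeAt (fun _ : Fin 1 => G) ax with haE
  have haE_anti : IsAntisymm aE := hax_anti.colourChangeAt _
  have hcaE : wordEval (cupPowOneAlt ℂ (Motives.ComplexPoints X.X) (2 * p)) (avLetters g eL) aE = c := by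
    rw [haE, ← wordEval_eq_wordEval_colourChangeAt _ (fun _ : Fin 1 => G) hletters ax, hcax]
  -- rationality of `aE`
  have hFinj : Function.Injective (exteriorPower.alternatingMapLinearEquiv
      (cupPowOneAlt ℂ (Motives.ComplexPoints X.X) (2 * p))) :=
    injective_alternatingMapLinearEquiv_cupPowOneAlt X (2 * p)
  obtain ⟨q, hq⟩ := hg.exists_rat_wordEval_eq eL heLQ hcQ
  obtain ⟨q', -, haEq⟩ := haE_anti.exists_eq_algebraMap_of_wordEval_eq hFinj (hg.letterBasis eL)
    (q := q) (by rw [AVSlots.coe_letterBasis, hcaE, hq])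
  have hslice_e : ∀ u, wordSlice aE u = wordRepAt ℂ (fun _ : Fin (2 * p) => G) (wordSlice ax u) :=
    fun u => wordSlice_colourChangeAt (fun _ : Fin 1 => G) ax u
  -- the Hodge operator `Θ` of `H¹(Y × E)`: `diag(±1)` in the adapted letters
  obtain ⟨Θ, hΘ⟩ := exists_hodgeTheta (BettiUniverse.hodge hHD hXP 1)
  have hΘb : ∀ m, Θ (cbσ m) = (if κ' m = 0 then (1 : ℂ) else -1) • cbσ m := by
    intro m
    rw [hcbσ]
    change Θ _ = (if (φ m).2 = 0 then (1 : ℂ) else -1) • _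
    rcases fin2_eq_zero_or_one_u (φ m).2 with h0 | h1
    · rw [h0, if_pos rfl]
      have hmem : cbx (φ m) ∈ (BettiUniverse.hodge hHD hXP 1).piece 1 (((1 : ℕ) : ℤ) - 1) := by
        have e : (((1 : ℕ) : ℤ) - 1) = 0 := by norm_num
        have hsplit : φ m = ((φ m).1, 0) := by rw [← h0]
        rw [e, hsplit]; exact hcbx0 _
      rw [hΘ 1 _ hmem]
      norm_num
    · rw [h1, if_neg one_ne_zero]
      have hmem : cbx (φ m) ∈ (BettiUniverse.hodge hHD hXP 1).piece 0 (((1 : ℕ) : ℤ) - 0) := by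
        have e : (((1 : ℕ) : ℤ) - 0) = 1 := by norm_num
        have hsplit : φ m = ((φ m).1, 1) := by rw [← h1]
        rw [e, hsplit]; exact hcbx1 _
      rw [hΘ 0 _ hmem]
      norm_num
  have hΘcb : LinearMap.toMatrix cbσ cbσ Θ = kindDiag κ' := by
    ext i m
    rw [LinearMap.toMatrix_apply, hΘb, map_smul, Module.Basis.repr_self, Finsupp.smul_apply,
      Finsupp.single_apply, kindDiag, Matrix.diagonal_apply, smul_eq_mul, mul_ite, mul_one, mul_zero]
    by_cases him : i = m
    · subst him; rw [if_pos rfl]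
    · rw [if_neg (Ne.symm him), if_neg him]
  have hJG : LinearMap.toMatrix eC eC Θ * G = G * kindDiag κ' := by
    rw [← hΘcb, hG, linearMap_toMatrix_mul_basis_toMatrix, basis_toMatrix_mul_linearMap_toMatrix]
  have hΘq : ∀ u : Fin (2 * p) → Fin 1, wordDerAt ℂ (fun _ : Fin (2 * p) => LinearMap.toMatrix eC eC Θ)
      (wordSlice (fun w => algebraMap ℚ ℂ (q' w)) u) = 0 := by
    intro u
    rw [← haEq, hslice_e]
    refine wordDerAt_wordRepAt_eq_zero_of_mul_eq ℂ (fun _ : Fin (2 * p) => G) (fun _ => hJG) ?_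
    rw [wordDerAt_const]
    exact wordDer_kindDiag_wordSlice_eq_zero κ' hax_bal u
  -- the Hodge operators `Θ_Y`, `Θ_E`, and the data of the CM curve
  obtain ⟨ΘA, hΘA⟩ := exists_hodgeTheta (BettiUniverse.hodge hHD hXA 1)
  obtain ⟨ΘC, hΘC⟩ := exists_hodgeTheta (BettiUniverse.hodge hHD hXC 1)
  have hχE := pullback_mem_endAlg hHD hI χ
  have hχ2 : (bettiCohomology.map χ.hom.hom.hom 1).hom * (bettiCohomology.map χ.hom.hom.hom 1).hom =
      -((d' : ℚ) • 1) := bettiMapHom_mul_self hχ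
  have hd'Q : (0 : ℚ) < d' := Nat.cast_pos.2 hd'
  have hV₂ : Module.finrank ℚ (bettiCohomology E.X 1) = 2 := by rw [finrank_bettiCohomology_one E, hE1]
  -- structure of the adapted dual basis for `ψ_ℂ` and `φ_ℂ`
  set Ψ := ψ.form.baseChange ℂ with hΨ
  have hφskewC : ∀ x y, Ψ (φQ.baseChange ℂ x) y + Ψ x (φQ.baseChange ℂ y) = 0 := by
    haveI : Nontrivial (bettiCohomology Y.X 1) := by
      refine Module.nontrivial_of_finrank_pos (R := ℚ) ?_
      rw [finrank_bettiCohomology_one Y]; omega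
    exact ThetaSubalgebra.formBaseChange_add_eq_zero_of_skew ψ
      (UnitaryTheta.form_apply_add_form_apply_eq_zero _ ψ hφE hdQ hφ2 hE)
  have hiso0 : ∀ i j, Ψ (cb (0, i)) (cb (0, j)) = 0 := fun i j =>
    UnitaryTheta.form_eq_zero_of_mem_eigenspace hφskewC hμ0 (hcbW i) (hcbW j)
  have hiso1 : ∀ i j, Ψ (cb (1, i)) (cb (1, j)) = 0 := fun i j =>
    UnitaryTheta.form_eq_zero_of_mem_eigenspace hφskewC (neg_ne_zero.2 hμ0) (hcbW' i) (hcbW' j)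
  have hswap10 : ∀ i j, Ψ (cb (1, i)) (cb (0, j)) = -(if j = i then 1 else 0) := fun i j => by
    rw [hΨ, ψ.form_baseChange_swap, show (((1 : ℕ) : ℤ)).negOnePow = -1 from Int.negOnePow_one, ← hΨ, hdual]
    split_ifs <;> simp
  have hφcb0 : ∀ ℓ, φQ.baseChange ℂ (cb (0, ℓ)) = μ • cb (0, ℓ) := fun ℓ =>
    Module.End.mem_eigenspace_iff.1 (hcbW ℓ)
  have hφcb1 : ∀ ℓ, φQ.baseChange ℂ (cb (1, ℓ)) = (-μ) • cb (1, ℓ) := fun ℓ =>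
    Module.End.mem_eigenspace_iff.1 (hcbW' ℓ)
  -- the elementary operators `P_{ij} ∈ 𝔲_{k'}(H¹Y, ψ)_ℂ ≅ 𝔤𝔩(W)`: `e_j ↦ e_i`, `f_i ↦ -f_j`
  have hops : ∀ i j : Fin n₀, ∃ P : Module.End ℂ (ℂ ⊗[ℚ] bettiCohomology Y.X 1),
      (∀ ℓ, P (cb (0, ℓ)) = if ℓ = j then cb (0, i) else 0) ∧
      (∀ ℓ, P (cb (1, ℓ)) = if ℓ = i then -cb (1, j) else 0) ∧
      P * φQ.baseChange ℂ = φQ.baseChange ℂ * P ∧ (∀ x y, Ψ (P x) y + Ψ x (P y) = 0) := by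
    intro i j
    set P : Module.End ℂ (ℂ ⊗[ℚ] bettiCohomology Y.X 1) := cb.constr ℂ (fun tl : Fin 2 × Fin n₀ =>
      if tl.1 = 0 then (if tl.2 = j then cb (0, i) else 0) else (if tl.2 = i then -cb (1, j) else 0)) with hPdef
    have hP0 : ∀ ℓ, P (cb (0, ℓ)) = if ℓ = j then cb (0, i) else 0 := fun ℓ => by
      rw [hPdef, Module.Basis.constr_basis]; simp
    have hP1 : ∀ ℓ, P (cb (1, ℓ)) = if ℓ = i then -cb (1, j) else 0 := fun ℓ => by
      rw [hPdef, Module.Basis.constr_basis]; simp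
    refine ⟨P, hP0, hP1, ?_, ?_⟩
    · refine cb.ext fun tl => ?_
      obtain ⟨t, ℓ⟩ := tl
      rcases fin2_eq_zero_or_one_u t with rfl | rfl
      · rw [Module.End.mul_apply, Module.End.mul_apply, hφcb0, map_smul, hP0]
        by_cases hℓ : ℓ = j
        · rw [if_pos hℓ, hφcb0]
        · rw [if_neg hℓ, map_zero, smul_zero]
      · rw [Module.End.mul_apply, Module.End.mul_apply, hφcb1, map_smul, hP1]
        by_cases hℓ : ℓ = i
        · rw [if_pos hℓ, map_neg, hφcb1, smul_neg]
        · rw [if_neg hℓ, map_zero, smul_zero]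
    · have hB : Ψ ∘ₗ P + Ψ.compl₂ P = 0 := by
        refine LinearMap.BilinForm.ext_basis cb fun tk tl => ?_
        obtain ⟨t, k⟩ := tk
        obtain ⟨t', ℓ⟩ := tl
        rw [LinearMap.add_apply, LinearMap.add_apply, LinearMap.comp_apply, LinearMap.compl₂_apply,
          LinearMap.zero_apply, LinearMap.zero_apply]
        rcases fin2_eq_zero_or_one_u t with rfl | rfl <;> rcases fin2_eq_zero_or_one_u t' with rfl | rfl
        · rw [hP0, hP0]
          split_ifs <;> simp [hiso0]
        · rw [hP0, hP1]
          by_cases hk : k = j <;> by_cases hl : ℓ = i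
          · subst hk; subst hl; simp [hdual]
          · subst hk; rw [if_pos rfl, if_neg hl, map_zero, add_zero, hdual, if_neg (Ne.symm hl)]
          · subst hl; rw [if_neg hk, if_pos rfl, map_zero, LinearMap.zero_apply, zero_add, map_neg, hdual,
              if_neg hk, neg_zero]
          · rw [if_neg hk, if_neg hl, map_zero, LinearMap.zero_apply, map_zero, add_zero]
        · rw [hP1, hP0]
          by_cases hk : k = i <;> by_cases hl : ℓ = j
          · subst hk; subst hl; simp [hswap10]
          · subst hk; rw [if_pos rfl, if_neg hl, map_zero, add_zero, map_neg, LinearMap.neg_apply, hswap10,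
              if_neg hl, neg_zero, neg_zero]
          · subst hl; rw [if_neg hk, if_pos rfl, map_zero, LinearMap.zero_apply, zero_add, hswap10,
              if_neg (Ne.symm hk), neg_zero]
          · rw [if_neg hk, if_neg hl, map_zero, LinearMap.zero_apply, map_zero, add_zero]
        · rw [hP1, hP1]
          split_ifs <;> simp [hiso1]
      intro x y
      have h := LinearMap.congr_fun (LinearMap.congr_fun hB x) y
      simpa only [LinearMap.add_apply, LinearMap.comp_apply, LinearMap.compl₂_apply, LinearMap.zero_apply]
        using h
  -- the root differences `D_{ij} = [P_{ij}, P_{ji}] = E_ii - E_jj` (on `W`; `-(E_ii - E_jj)` on `W'`) kill the tensor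
  have hYG : ∀ Z : Module.End ℂ (ℂ ⊗[ℚ] bettiCohomology (Y.prod E).X 1), ∀ _t : Fin (2 * p),
      LinearMap.toMatrix eC eC Z * G = G * LinearMap.toMatrix cbσ cbσ Z :=
    fun Z _ => by rw [hG, linearMap_toMatrix_mul_basis_toMatrix, basis_toMatrix_mul_linearMap_toMatrix]
  -- the diagonal weights of `ι_Y D_{ij} π_Y`: `±([ℓ = i] - [ℓ = j])` at the `Y`-places (sign `+` iff in `W`), `0` at `E`
  set δ : Fin n₀ → Fin n₀ → (Fin n₀ ⊕ Fin h) → Fin 2 → ℤ := fun i j T r =>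
    Sum.elim (fun ℓ => (if r = κ ℓ then (1 : ℤ) else -1) * ((if ℓ = i then (1 : ℤ) else 0) - (if ℓ = j then 1 else 0)))
      (fun _ => (0 : ℤ)) T with hδ
  have hax : ∀ i j : Fin n₀, ∀ u : Fin (2 * p) → Fin 1,
      wordDerAt ℂ (fun _ : Fin (2 * p) => blockLift φ (fun T => Matrix.diagonal fun r => ((δ i j T r : ℤ) : ℂ)))
        (wordSlice ax u) = 0 := by
    intro i j u
    obtain ⟨P, hP0, hP1, hPφ, hPskew⟩ := hops i j
    obtain ⟨P', hP'0, hP'1, hP'φ, hP'skew⟩ := hops j i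
    -- `D` is diagonal on `cb`
    have hD0 : ∀ ℓ, (P * P' - P' * P) (cb (0, ℓ)) = (if ℓ = i then cb (0, ℓ) else 0) - (if ℓ = j then cb (0, ℓ) else 0) := by
      intro ℓ
      have hPj : P (cb (0, j)) = cb (0, i) := by rw [hP0, if_pos rfl]
      have hP'i : P' (cb (0, i)) = cb (0, j) := by rw [hP'0, if_pos rfl]
      rw [LinearMap.sub_apply, Module.End.mul_apply, Module.End.mul_apply, hP'0, hP0]
      by_cases hi : ℓ = i <;> by_cases hj : ℓ = j
      · simp only [if_pos hi, if_pos hj, hPj, hP'i]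
        rw [← hi, ← hj]
      · simp only [if_pos hi, if_neg hj, hPj, map_zero]
        rw [hi]
      · simp only [if_neg hi, if_pos hj, hP'i, map_zero]
        rw [hj]
      · simp only [if_neg hi, if_neg hj, map_zero, sub_self]
    have hD1 : ∀ ℓ, (P * P' - P' * P) (cb (1, ℓ)) = (if ℓ = j then cb (1, ℓ) else 0) - (if ℓ = i then cb (1, ℓ) else 0) := by
      intro ℓ
      have hPi : P (cb (1, i)) = -cb (1, j) := by rw [hP1, if_pos rfl]
      have hP'j : P' (cb (1, j)) = -cb (1, i) := by rw [hP'1, if_pos rfl]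
      have hPi' : P (-cb (1, i)) = cb (1, j) := by rw [map_neg P (cb (1, i)), hPi, neg_neg]
      have hP'j' : P' (-cb (1, j)) = cb (1, i) := by rw [map_neg P' (cb (1, j)), hP'j, neg_neg]
      rw [LinearMap.sub_apply, Module.End.mul_apply, Module.End.mul_apply, hP'1, hP1]
      by_cases hi : ℓ = i <;> by_cases hj : ℓ = j
      · simp only [if_pos hi, if_pos hj, hPi', hP'j']
        rw [← hi, ← hj]
      · simp only [if_pos hi, if_neg hj, map_zero, hP'j']
        rw [hi]
      · simp only [if_neg hi, if_pos hj, hPi', map_zero]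
        rw [hj]
      · simp only [if_neg hi, if_neg hj, map_zero, sub_self]
    have hDbY : ∀ ℓ r, (P * P' - P' * P) (bY (ℓ, r)) = ((δ i j (Sum.inl ℓ) r : ℤ) : ℂ) • bY (ℓ, r) := by
      intro ℓ r
      rw [hbY]
      by_cases hr : r = κ ℓ
      · rw [if_pos hr, hD0, ite_sub_ite_eq_cast_smul_u]
        congr 2
        simp only [hδ, Sum.elim_inl, if_pos hr]
        ring
      · rw [if_neg hr, hD1, ite_sub_ite_eq_cast_smul_u]
        congr 2
        simp only [hδ, Sum.elim_inl, if_neg hr]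
        ring
    -- the Lie step: `ι_Y D π_Y` kills the rational coefficient tensor
    have hL : wordDerAt ℂ (fun _ : Fin (2 * p) => LinearMap.toMatrix eC eC
          (ι₁.baseChange ℂ ∘ₗ (P * P' - P' * P) ∘ₗ π₁.baseChange ℂ))
        (wordSlice (fun w => algebraMap ℚ ℂ (q' w)) u) = 0 :=
      wordDerAt_incl_bracket_proj_eq_zero_of_unitary_times_cmCurve hn1 (BettiUniverse.hodge hHD hXP 1)
        (BettiUniverse.hodge hHD hXA 1) (BettiUniverse.hodge hHD hXC 1) heffA
        (BettiUniverse.hodge_isEffective hHD hXC 1) hπι₁ hπι₂ hπ₁ι₂ hπ₂ι₁ hsum hι₁F hι₂F ψ ψC hφE hdQ hφ2 hE hμ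
        h1' h2' hχE hd'Q hχ2 hV₂ eQ q' hΘ hΘA hΘC hΘq hPφ hPskew hP'φ hP'skew u
    -- the matrix of `Z` in the pair letters is the diagonal block family
    have hblk : LinearMap.toMatrix cbσ cbσ (ι₁.baseChange ℂ ∘ₗ (P * P' - P' * P) ∘ₗ π₁.baseChange ℂ) =
        blockLift φ (fun T => Matrix.diagonal fun r => ((δ i j T r : ℤ) : ℂ)) := by
      refine toMatrix_eq_blockLift_of_apply_basis φ cbσ _ _ fun m => ?_
      rw [hcbσ m]
      have hb' : ∀ a, cbσ (φ.symm ((φ m).1, a)) = cbx ((φ m).1, a) := fun a => by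
        rw [hcbσ, Equiv.apply_symm_apply]
      simp only [hb']
      obtain ⟨T, r⟩ := φ m
      rw [Finset.sum_eq_single r]
      · rw [Matrix.diagonal_apply_eq]
        rcases T with ℓ | e
        · simp only [hcbx, Sum.elim_inl]
          rw [LinearMap.comp_apply, LinearMap.comp_apply, e11, hDbY, map_smul]
        · simp only [hcbx, Sum.elim_inr]
          rw [LinearMap.comp_apply, LinearMap.comp_apply, e12, map_zero, map_zero]
          have h0 : ((δ i j (Sum.inr e) r : ℤ) : ℂ) = 0 := by simp only [hδ, Sum.elim_inr, Int.cast_zero]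
          rw [h0, zero_smul]
      · intro a _ ha
        simp only [Matrix.diagonal_apply_ne _ ha, zero_smul]
      · intro hr; exact absurd (Finset.mem_univ r) hr
    have hLu := hL
    rw [← haEq, hslice_e] at hLu
    have h3 : wordRepAt ℂ (fun _ : Fin (2 * p) => G)
        (wordDerAt ℂ (fun _ : Fin (2 * p) => blockLift φ (fun T => Matrix.diagonal fun r => ((δ i j T r : ℤ) : ℂ)))
          (wordSlice ax u)) = 0 := by
      rw [← hblk, wordRepAt_wordDerAt_of_mul_eq ℂ (fun _ : Fin (2 * p) => G) (hYG _), hLu]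
    exact wordRepAt_injective ℂ (g := fun _ : Fin (2 * p) => G) (g' := fun _ : Fin (2 * p) => G')
      (funext fun _ => hG'G) (by rw [h3, map_zero])
  -- the coefficient function, refined to slot-and-place colours
  refine ⟨placeRefine φ ax, ?_, fun U η hU => ?_⟩
  · rw [← hcax]
    have hx : (fun jr : (Fin 1 × (Fin n₀ ⊕ Fin h)) × Fin 2 => avLetters g v (jr.1.1, φ.symm (jr.1.2, jr.2))) =
        fun jr : (Fin 1 × (Fin n₀ ⊕ Fin h)) × Fin 2 => complexBetti.map (g jr.1.1).hom.hom.hom 1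
          (Sum.elim
            (fun i => complexBetti.map (Motives.AbelianVariety.fst Y E).hom.hom.hom 1
              (ofRatClassBaseChange (Motives.ComplexPoints Y.X) 1 (bY (i, jr.2))))
            (fun i => complexBetti.map (Motives.AbelianVariety.snd Y E).hom.hom.hom 1
              (ofRatClassBaseChange (Motives.ComplexPoints E.X) 1 (cC (i, jr.2))))
            jr.1.2) := by
      funext jr
      rw [avLetters_apply, hv_apply, Equiv.apply_symm_apply, hcbx]
      obtain ⟨⟨j, t⟩, r⟩ := jr
      rcases t with i | i
      · simp only [Sum.elim_inl]
        congr 1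
        rw [hι₁, ← ofRatClassBaseChangeEquiv_apply (hX := hXP), ← ofRatClassBaseChangeEquiv_apply (hX := hXA),
          complexBetti_map_ofRatClassBaseChangeEquiv hXP hXA]
      · simp only [Sum.elim_inr]
        congr 1
        rw [hι₂, ← ofRatClassBaseChangeEquiv_apply (hX := hXP), ← ofRatClassBaseChangeEquiv_apply (hX := hXC),
          complexBetti_map_ofRatClassBaseChangeEquiv hXP hXC]
    rw [← hx]
    exact wordEval_placeRefine _ φ (avLetters g v) ax
  · -- words with a repeated letter: antisymmetry
    by_cases hinjw : Function.Injective (fun t => (U t, η t))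
    swap
    · exact (hax_anti.placeRefine φ).apply_eq_zero_of_not_injective hinjw
    -- words without repeated letters: the combinatorial core
    by_contra hne
    -- `Θ`-balance
    have hval : placeRefine φ ax (fun t => (U t, η t)) = ax (fun t => ((U t).1, φ.symm ((U t).2, η t))) := rfl
    have hbal := hax_bal _ (by rw [← hval]; exact hne)
    have hcnt : ∀ r : Fin 2, (Finset.univ.filter fun t => η t = r).card = p := by
      intro r
      have hb := hbal r
      simp only [wordContent, hκ', Equiv.apply_symm_apply] at hb
      exact hb
    have hΘw : ∑ t, (if η t = 0 then (1 : ℤ) else -1) = 0 := by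
      rw [sum_kindSign_eq_card_sub_card Finset.univ η, hcnt 0, hcnt 1, sub_self]
    -- root-difference weights
    have hDw : ∀ i j : Fin n₀, ∑ t, Sum.elim (fun ℓ => (if η t = κ ℓ then (1 : ℤ) else -1) *
        ((if ℓ = i then (1 : ℤ) else 0) - (if ℓ = j then (1 : ℤ) else 0))) (fun _ => (0 : ℤ)) (U t).2 = 0 := by
      intro i j
      have h2 : wordDerAt ℂ (fun t => Matrix.diagonal fun r => ((δ i j (U t).2 r : ℤ) : ℂ))
          (wordSlice (placeRefine φ ax) U) = 0 :=
        wordDerAt_placeFamily_placeRefine_eq_zero φ (fun T => Matrix.diagonal fun r => ((δ i j T r : ℤ) : ℂ)) (hax i j) U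
      by_contra hw
      refine hne (eq_zero_of_wordDerAt_diagonal_eq_zero (fun t r => ((δ i j (U t).2 r : ℤ) : ℂ)) h2 η ?_)
      rw [← Int.cast_sum, Int.cast_ne_zero]
      simpa only [hδ] using hw
    -- injectivity of the place-and-kind word (ONE slot)
    have hinjP : Function.Injective fun t => ((U t).2, η t) := by
      intro t t' htt
      simp only [Prod.mk.injEq] at htt
      refine hinjw ?_
      simp only [Prod.mk.injEq]
      exact ⟨Prod.ext (Subsingleton.elim _ _) htt.1, htt.2⟩
    have hcore := sum_kindSign_inl_eq_zero_of_rootDiffWeights κ (fun t => (U t).2) η hinjP (by omega) hκ hΘw hDw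
    refine hU ?_
    have hcast : ∀ t, Sum.elim (fun _ : Fin n₀ => if η t = 0 then (1 : ℂ) else -1) (fun _ : Fin h => (0 : ℂ)) (U t).2 =
        ((Sum.elim (fun _ : Fin n₀ => if η t = 0 then (1 : ℤ) else -1) (fun _ : Fin h => (0 : ℤ)) (U t).2 : ℤ) : ℂ) := by
      intro t
      rcases (U t).2 with ℓ | e
      · simp only [Sum.elim_inl]; split_ifs <;> simp
      · simp
    simp only [hcast]
    rw [← Int.cast_sum, hcore, Int.cast_zero]

end Invariance

/-! ### §4 The product span for `Y × E` -/

section ProductSpan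

open MonoidalCategory CartesianMonoidalCategory

variable {Y B E Z : AbelianVariety ℂ} {gB : Fin 1 → (B ⟶ Y)} {gE : Fin 1 → (Z ⟶ E)}

/-- **`HodgeClassesProductSpan B Z` for ONE slot over `Y` and ONE slot over `E`**, `Y` of unitary type
`(dim Y − 1, 1)` with `dim Y ≥ 4` (`dim_ℚ End⁰(Y) = 2`, `φ ≫ φ = -d`, one multiplicity equal to `1`), `E` an elliptic
curve with `χ ≫ χ = -d'` — NO condition relating `d` and `d'` (Moonen–Zarhin Thm. 0.2 (3) with case (g): «the Hodge ring
`B•(X)` is generated by divisor classes»; §5 (5.12): «there are no Hodge classes in `H¹(X₁) ⊗ H³(X₂)`»): every rational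
`(p,p)`-class on `B × Z` is a `ℂ`-combination of exterior products `pr_B^* a ⌣ pr_Z^* b` of RATIONAL HODGE classes — the
tree's typed-Künneth pipeline (`hodgeClassesProductSpan_of_avSlots_of_quadraticEnd_cmCurve`, verbatim) fed by the
invariance theorem `AVSlots.exists_coeff_eq_zero_off_balanced_of_prod_unitaryTypeOne_cmCurve`.
[cite: MoonenZarhin1999LowDim, Thm. 0.2 (3) and §5 (5.11)–(5.12)] [cite: MoonenZarhin1999LowDim, §3 (3.1)]
[cite: Lombardo2016, Lemma 3.4 (p. 1229)] -/
theorem hodgeClassesProductSpan_of_avSlots_one_of_unitaryTypeOne_cmCurve (hY4 : 4 ≤ Y.dim)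
    (hY2 : Module.finrank ℚ Y.endAlgebra = 2) (φY : Y ⟶ Y) {d : ℕ} (hd : 0 < d) (hφY : φY ≫ φY = -(d • 𝟙 Y))
    (hm1 : eigenMultiplicity Y φY (Complex.I * (Real.sqrt d : ℂ)) = 1 ∨
      eigenMultiplicity Y φY (-(Complex.I * (Real.sqrt d : ℂ))) = 1)
    (hE1 : E.dim = 1) (χ : E ⟶ E) {d' : ℕ} (hd' : 0 < d') (hχ : χ ≫ χ = -(d' • 𝟙 E))
    (hgB : AVSlots Y B gB) (hgE : AVSlots E Z gE) : HodgeClassesProductSpan B Z := by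
  classical
  intro p c hcQ hc
  have hB : IsSmoothProjective B.dim B.X := Motives.AbelianVariety.isSmoothProjective_holds
  have hZ : IsSmoothProjective Z.dim Z.X := Motives.AbelianVariety.isSmoothProjective_holds
  have hXA : IsSmoothProjective Y.dim Y.X := Motives.AbelianVariety.isSmoothProjective_holds
  have hXC : IsSmoothProjective E.dim E.X := Motives.AbelianVariety.isSmoothProjective_holds
  obtain ⟨hA, bA, h, cC, hbA0, hbA1, hcC0, hcC1, hmain⟩ :=
    (hgB.prodLift hgE).exists_coeff_eq_zero_off_balanced_of_prod_unitaryTypeOne_cmCurve hY4 hY2 φY hd hφY hm1 hE1 χ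
      hd' hχ
  have hc' : IsOfHodgeType (B.prod Z).dim (B.prod Z).X (2 * p) p p c := by
    rw [Motives.AbelianVariety.dim_prod]; exact hc
  rcases Nat.eq_zero_or_pos p with rfl | hp
  · -- degree `0`: `c = s · 1 = pr_B^*(s · 1_B) ⌣ pr_Z^* 1_Z`
    have h1 : c ∈ Submodule.span ℂ {singularCohomology.one ℂ (ComplexPoints (B.X ⊗ Z.X))} :=
      mem_divisorClassesSpan_zero (N := B.dim + Z.dim) (IsSmoothProjective.tensor_holds hB hZ) c
    obtain ⟨s, hs⟩ := Submodule.mem_span_singleton.1 h1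
    refine mem_span_hodgeProductClasses_of_mem_span_pureType B Z hcQ hc (Submodule.subset_span ?_)
    refine ⟨0, 0, rfl, s • singularCohomology.one ℂ (ComplexPoints B.X), singularCohomology.one ℂ (ComplexPoints Z.X),
      ⟨0, rfl, isOfHodgeType_zero_zero_of_degree_zero hB _⟩,
      ⟨0, 0, rfl, isOfHodgeType_zero_zero_of_degree_zero hZ _⟩, ?_⟩
    rw [← hs, map_smul, LinearMap.map_smul₂]
    erw [singularCohomology.map_one, singularCohomology.map_one, cupProduct_one]
  · obtain ⟨a, hca, hkill⟩ := hmain hp hcQ hc'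
    -- the letters of `B × Z` over `Y × E` are `pr_B^*`(letters of `B` over `Y`) and `pr_Z^*`(letters of `Z` over `E`)
    set xA : (Fin 1 × Fin hA) × Fin 2 → complexBetti B.X 1 := fun jr =>
      complexBetti.map (gB jr.1.1).hom.hom.hom 1 (ofRatClassBaseChange (ComplexPoints Y.X) 1 (bA (jr.1.2, jr.2)))
      with hxA
    set y : (Fin 1 × Fin h) × Fin 2 → complexBetti Z.X 1 := fun jr =>
      complexBetti.map (gE jr.1.1).hom.hom.hom 1 (ofRatClassBaseChange (ComplexPoints E.X) 1 (cC (jr.1.2, jr.2)))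
      with hy
    have hletters : (fun jr : (Fin 1 × (Fin hA ⊕ Fin h)) × Fin 2 => complexBetti.map
        (Motives.AbelianVariety.prodLift (Motives.AbelianVariety.fst B Z ≫ gB jr.1.1)
          (Motives.AbelianVariety.snd B Z ≫ gE jr.1.1)).hom.hom.hom 1
        (Sum.elim
          (fun i => complexBetti.map (Motives.AbelianVariety.fst Y E).hom.hom.hom 1
            (ofRatClassBaseChange (ComplexPoints Y.X) 1 (bA (i, jr.2))))
          (fun i => complexBetti.map (Motives.AbelianVariety.snd Y E).hom.hom.hom 1
            (ofRatClassBaseChange (ComplexPoints E.X) 1 (cC (i, jr.2))))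
          jr.1.2)) =
        fun jr : (Fin 1 × (Fin hA ⊕ Fin h)) × Fin 2 => Sum.elim
          (fun i => complexBetti.map (Motives.AbelianVariety.fst B Z).hom.hom.hom 1 (xA ((jr.1.1, i), jr.2)))
          (fun i => complexBetti.map (Motives.AbelianVariety.snd B Z).hom.hom.hom 1 (y ((jr.1.1, i), jr.2)))
          jr.1.2 := by
      funext jr
      obtain ⟨⟨j, t⟩, κ⟩ := jr
      rcases t with i | i
      · simp only [Sum.elim_inl, hxA]
        rw [complexBetti_map_map_hom, complexBetti_map_map_hom, Motives.AbelianVariety.prodLift_fst]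
      · simp only [Sum.elim_inr, hy]
        rw [complexBetti_map_map_hom, complexBetti_map_map_hom, Motives.AbelianVariety.prodLift_snd]
    -- types of the letters
    have hxA0 : ∀ jr : (Fin 1 × Fin hA) × Fin 2, jr.2 = 0 → IsOfHodgeType B.dim B.X 1 1 0 (xA jr) := by
      rintro ⟨⟨j, i⟩, κ⟩ hκ
      change κ = 0 at hκ
      subst hκ
      exact (hbA0 i).map_of_isSmoothProjective hB hXA _
    have hxA1 : ∀ jr : (Fin 1 × Fin hA) × Fin 2, jr.2 = 1 → IsOfHodgeType B.dim B.X 1 0 1 (xA jr) := by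
      rintro ⟨⟨j, i⟩, κ⟩ hκ
      change κ = 1 at hκ
      subst hκ
      exact (hbA1 i).map_of_isSmoothProjective hB hXA _
    have hy0 : ∀ jr : (Fin 1 × Fin h) × Fin 2, jr.2 = 0 → IsOfHodgeType Z.dim Z.X 1 1 0 (y jr) := by
      rintro ⟨⟨j, i⟩, κ⟩ hκ
      change κ = 0 at hκ
      subst hκ
      exact (hcC0 i).map_of_isSmoothProjective hZ hXC _
    have hy1 : ∀ jr : (Fin 1 × Fin h) × Fin 2, jr.2 = 1 → IsOfHodgeType Z.dim Z.X 1 0 1 (y jr) := by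
      rintro ⟨⟨j, i⟩, κ⟩ hκ
      change κ = 1 at hκ
      subst hκ
      exact (hcC1 i).map_of_isSmoothProjective hZ hXC _
    -- evaluate and feed the typed criterion
    have hmem := wordEval_mem_span_typed_cup_pureType_of_eq_zero_off_balanced
      (Motives.AbelianVariety.fst B Z) (Motives.AbelianVariety.snd B Z) xA y hxA0 hxA1 hy0 hy1 hkill
    rw [← hletters, hca] at hmem
    refine mem_span_hodgeProductClasses_of_mem_span_pureType B Z hcQ hc (Submodule.span_mono ?_ hmem)
    rintro z ⟨i, j, hij, d, μ, hd, hμ, rfl⟩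
    exact ⟨i, j, hij, d, μ, hd, hμ, rfl⟩

/-- **`HodgeClassesProductSpan Y E`**: the Hodge classes of `Y × E` are spanned by products of Hodge classes of the
factors (one slot on each side, `avSlots_self`). For `k = ℚ(√-d') ≇ ℚ(√-d)` this is also the tree's
`hodgeClassesProductSpan_of_quadraticEnd_cmCurve` (all slots); the present theorem covers the RESONANT case `k ↪ End⁰(Y)`
(Moonen–Zarhin's case (g)), for `Y × E` itself. [cite: MoonenZarhin1999LowDim, Thm. 0.2 (3) and §5 (5.11)–(5.12)] -/
theorem hodgeClassesProductSpan_of_unitaryTypeOne_cmCurve (hY4 : 4 ≤ Y.dim) (hY2 : Module.finrank ℚ Y.endAlgebra = 2)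
    (φY : Y ⟶ Y) {d : ℕ} (hd : 0 < d) (hφY : φY ≫ φY = -(d • 𝟙 Y))
    (hm1 : eigenMultiplicity Y φY (Complex.I * (Real.sqrt d : ℂ)) = 1 ∨
      eigenMultiplicity Y φY (-(Complex.I * (Real.sqrt d : ℂ))) = 1)
    (hE1 : E.dim = 1) (χ : E ⟶ E) {d' : ℕ} (hd' : 0 < d') (hχ : χ ≫ χ = -(d' • 𝟙 E)) :
    HodgeClassesProductSpan Y E :=
  hodgeClassesProductSpan_of_avSlots_one_of_unitaryTypeOne_cmCurve hY4 hY2 φY hd hφY hm1 hE1 χ hd' hχ (avSlots_self Y)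
    (avSlots_self E)

end ProductSpan

/-! ### §5 `B•(Y × E) = D•(Y × E)`, the Hodge conjecture for `Y × E`, and Moonen–Zarhin's case (g) with `End⁰(Y) = k` -/

section DivisorGenerated

open Literature.AlgebraicGeometry.Milne1999 (IsOfCMType)

variable {Y E : AbelianVariety ℂ}

/-- **`B•(Y × E) = D•(Y × E) ⊗ ℂ`** for `Y` of unitary type `(dim Y − 1, 1)`, `dim Y ≥ 4`, and `E` an elliptic curve with
`χ ≫ χ = -d'` (ANY `d'`): product span (§4) + `B•(Y) = D•(Y)` (Ribet type one, the tree's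
`AbelianVariety.isDivisorGenerated_of_ribetTypeOne`) + `B•(E) = D•(E)` (`dim E ≤ 3`) — UNCONDITIONAL.
[cite: MoonenZarhin1999LowDim, Thm. 0.2 (3) and §5 (5.12)] [cite: Ribet1983, Thm. 3] [cite: vanGeemen1994HodgeAV, §2.4–2.5] -/
theorem isDivisorGenerated_prod_cmCurve_of_unitaryTypeOne (hY4 : 4 ≤ Y.dim) (hY2 : Module.finrank ℚ Y.endAlgebra = 2)
    (φY : Y ⟶ Y) {d : ℕ} (hd : 0 < d) (hφY : φY ≫ φY = -(d • 𝟙 Y))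
    (hm1 : eigenMultiplicity Y φY (Complex.I * (Real.sqrt d : ℂ)) = 1 ∨
      eigenMultiplicity Y φY (-(Complex.I * (Real.sqrt d : ℂ))) = 1)
    (hE1 : E.dim = 1) (χ : E ⟶ E) {d' : ℕ} (hd' : 0 < d') (hχ : χ ≫ χ = -(d' • 𝟙 E)) :
    IsDivisorGenerated (Y.prod E) :=
  isDivisorGenerated_prod_of_productSpan Y E
    (hodgeClassesProductSpan_of_unitaryTypeOne_cmCurve hY4 hY2 φY hd hφY hm1 hE1 χ hd' hχ)
    (AbelianVariety.isDivisorGenerated_of_ribetTypeOne Y φY hd hφY hY2 hm1 (by omega))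
    (isDivisorGenerated_of_dim_le_three E (by omega))

/-- The order `E × Y`: `B•(E × Y) = D•(E × Y) ⊗ ℂ` (isogeny `E × Y ∼ Y × E`).
[cite: MoonenZarhin1999LowDim, Thm. 0.2 (3) and §5 (5.12)] [cite: vanGeemen1994HodgeAV, §3.6 (p. 236)] -/
theorem isDivisorGenerated_cmCurve_prod_of_unitaryTypeOne (hY4 : 4 ≤ Y.dim) (hY2 : Module.finrank ℚ Y.endAlgebra = 2)
    (φY : Y ⟶ Y) {d : ℕ} (hd : 0 < d) (hφY : φY ≫ φY = -(d • 𝟙 Y))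
    (hm1 : eigenMultiplicity Y φY (Complex.I * (Real.sqrt d : ℂ)) = 1 ∨
      eigenMultiplicity Y φY (-(Complex.I * (Real.sqrt d : ℂ))) = 1)
    (hE1 : E.dim = 1) (χ : E ⟶ E) {d' : ℕ} (hd' : 0 < d') (hχ : χ ≫ χ = -(d' • 𝟙 E)) :
    IsDivisorGenerated (E.prod Y) :=
  (isDivisorGenerated_prod_cmCurve_of_unitaryTypeOne hY4 hY2 φY hd hφY hm1 hE1 χ hd' hχ).of_isIsogenous
    (isIsogenous_prod_swap E Y)

/-- **The Hodge conjecture for `Y × E`** — UNCONDITIONAL (`B = D` and Lefschetz `(1,1)`, the tree's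
`hodgeConjectureFor_of_isDivisorGenerated`). [cite: MoonenZarhin1999LowDim, Thm. 0.2 (3)] [cite: vanGeemen1994HodgeAV, §2.4] -/
theorem hodgeConjectureFor_prod_cmCurve_of_unitaryTypeOne (hY4 : 4 ≤ Y.dim) (hY2 : Module.finrank ℚ Y.endAlgebra = 2)
    (φY : Y ⟶ Y) {d : ℕ} (hd : 0 < d) (hφY : φY ≫ φY = -(d • 𝟙 Y))
    (hm1 : eigenMultiplicity Y φY (Complex.I * (Real.sqrt d : ℂ)) = 1 ∨
      eigenMultiplicity Y φY (-(Complex.I * (Real.sqrt d : ℂ))) = 1)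
    (hE1 : E.dim = 1) (χ : E ⟶ E) {d' : ℕ} (hd' : 0 < d') (hχ : χ ≫ χ = -(d' • 𝟙 E)) :
    HodgeConjectureFor (Y.prod E).dim (Y.prod E).X :=
  hodgeConjectureFor_of_isDivisorGenerated _
    (isDivisorGenerated_prod_cmCurve_of_unitaryTypeOne hY4 hY2 φY hd hφY hm1 hE1 χ hd' hχ)

/-- **Everything isogenous to `Y × E`** has `B = D` and satisfies the Hodge conjecture (van Geemen §3.6, Lemma 3.7).
[cite: vanGeemen1994HodgeAV, §3.6 (p. 236) and Lemma 3.7] [cite: MoonenZarhin1999LowDim, Thm. 0.2 (3)] -/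
theorem hodgeConjectureFor_of_isIsogenous_prod_cmCurve_of_unitaryTypeOne {X : AbelianVariety ℂ} (hY4 : 4 ≤ Y.dim)
    (hY2 : Module.finrank ℚ Y.endAlgebra = 2) (φY : Y ⟶ Y) {d : ℕ} (hd : 0 < d) (hφY : φY ≫ φY = -(d • 𝟙 Y))
    (hm1 : eigenMultiplicity Y φY (Complex.I * (Real.sqrt d : ℂ)) = 1 ∨
      eigenMultiplicity Y φY (-(Complex.I * (Real.sqrt d : ℂ))) = 1)
    (hE1 : E.dim = 1) (χ : E ⟶ E) {d' : ℕ} (hd' : 0 < d') (hχ : χ ≫ χ = -(d' • 𝟙 E))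
    (hX : AbelianVariety.IsIsogenous X (Y.prod E)) :
    IsDivisorGenerated X ∧ HodgeConjectureFor X.dim X.X :=
  have hD := (isDivisorGenerated_prod_cmCurve_of_unitaryTypeOne hY4 hY2 φY hd hφY hm1 hE1 χ hd' hχ).of_isIsogenous hX
  ⟨hD, hodgeConjectureFor_of_isDivisorGenerated _ hD⟩

/-- **Moonen–Zarhin 1999 Thm. 0.2 (3), case (g) with `End⁰(X₂) = k` — a THEOREM**: «(g) The abelian variety `X` is isogenous
to a product `X₁ × X₂` where `X₁` is an elliptic curve with complex multiplication by an imaginary quadratic field `k` and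
where `X₂` is a simple abelian fourfold such that there exists an embedding `k ↪ End⁰(X₂)` via which `k` acts on `T_{X₂,0}`
with multiplicities `(1,3)` … (3) Suppose we are in case (g). Then the Hodge ring `B•(X)` is generated by divisor classes,
i.e., `B•(X) = D•(X)`», here for `End⁰(X₂) = k` (`dim_ℚ End⁰(X₂) = 2`, `φ ≫ φ = -d`, multiplicity `1` at `± i√d`) and
`X₁` ANY elliptic curve of CM type (the embedding `k ↪ End⁰(X₂)` is not needed; without it the statement is also the tree's
`RankOneCentreTimesCMCurveProductSpan`). Simplicity of `X₂` is not used. UNCONDITIONAL; with the Hodge conjecture for `X`.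
-- TODO(general form): case (g) with `End⁰(X₂) ⊋ k` (a CM field of degree `4` or `8` containing `k`) is not covered.
[cite: MoonenZarhin1999LowDim, Thm. 0.2 (3) with case (g) and §5 (5.11) Case 2, (5.12)] -/
theorem isDivisorGenerated_of_isIsogenous_cmCurve_prod_fourfold_caseG {X X₁ X₂ : AbelianVariety ℂ} (hX₁ : X₁.dim = 1)
    (hX₁cm : IsOfCMType X₁) (hX₂ : X₂.dim = 4) (hX₂2 : Module.finrank ℚ X₂.endAlgebra = 2) (φ : X₂ ⟶ X₂) {d : ℕ}
    (hd : 0 < d) (hφ : φ ≫ φ = -(d • 𝟙 X₂))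
    (hm1 : eigenMultiplicity X₂ φ (Complex.I * (Real.sqrt d : ℂ)) = 1 ∨
      eigenMultiplicity X₂ φ (-(Complex.I * (Real.sqrt d : ℂ))) = 1)
    (hX : AbelianVariety.IsIsogenous X (X₁.prod X₂)) :
    IsDivisorGenerated X ∧ HodgeConjectureFor X.dim X.X := by
  obtain ⟨χ, d', hd', hχ⟩ := exists_hom_comp_self_eq_neg_of_cmCurve hX₁ hX₁cm
  have hD := (isDivisorGenerated_cmCurve_prod_of_unitaryTypeOne (by omega) hX₂2 φ hd hφ hm1 hX₁ χ hd' hχ).of_isIsogenous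
    hX
  exact ⟨hD, hodgeConjectureFor_of_isDivisorGenerated _ hD⟩

/-- **`B•(Y × E) = D•(Y × E) ⊗ ℂ` for EVERY elliptic curve `E`**, `Y` SIMPLE of unitary type `(dim Y − 1, 1)` with
`dim Y ≥ 4` and `dim_ℚ End⁰(Y) = 2`: `E` not of CM type ⟹ `Hom(Y, E) = 0` (simple, different dimensions) and the
tree's `hodgeClassesProductSpan_of_nonCMCurve_of_forall_hom_eq_zero` (Moonen–Zarhin Lemma (3.4) / Prop. (3.8):
«either `Hg(X × E) = Hg(X) × Hg(E)` or `End⁰(E) = k` is an imaginary quadratic field …»); `E` of CM type ⟹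
`isDivisorGenerated_prod_cmCurve_of_unitaryTypeOne` (ANY `k`, resonant or not).
[cite: MoonenZarhin1999LowDim, Thm. 0.2 (3)–(4) and §3 Lemma (3.4), Prop. (3.8)] [cite: SilvermanAEC2009, III.9 Cor. 9.4] -/
theorem isDivisorGenerated_prod_curve_of_isSimple_unitaryTypeOne (hYs : Y.IsSimple) (hY4 : 4 ≤ Y.dim)
    (hY2 : Module.finrank ℚ Y.endAlgebra = 2) (φY : Y ⟶ Y) {d : ℕ} (hd : 0 < d) (hφY : φY ≫ φY = -(d • 𝟙 Y))
    (hm1 : eigenMultiplicity Y φY (Complex.I * (Real.sqrt d : ℂ)) = 1 ∨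
      eigenMultiplicity Y φY (-(Complex.I * (Real.sqrt d : ℂ))) = 1)
    (hE1 : E.dim = 1) : IsDivisorGenerated (Y.prod E) := by
  open Literature.NumberTheory.ComplexMultiplication in
  rcases finrank_endAlgebra_eq_one_or_two (A₀ := E) hE1 with h1 | h2
  · exact isDivisorGenerated_prod_of_productSpan Y E
      (hodgeClassesProductSpan_of_nonCMCurve_of_forall_hom_eq_zero hE1 h1 fun u =>
        hom_eq_zero_of_isSimple_of_dim_ne hYs (Motives.AbelianVariety.isSimple_of_dim_le_one hE1.le) (by omega) u)
      (AbelianVariety.isDivisorGenerated_of_ribetTypeOne Y φY hd hφY hY2 hm1 (by omega))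
      (isDivisorGenerated_of_dim_le_three E (by omega))
  · open Literature.NumberTheory.ComplexMultiplication in
    have hEcm : IsOfCMType E := (EllipticCurve.isOfCMType_iff_finrank_end_eq_two hE1).2
      (by rw [AbelianVariety.finrank_int_end_eq_finrank_endAlgebra]; exact h2)
    obtain ⟨χ, d', hd', hχ⟩ := exists_hom_comp_self_eq_neg_of_cmCurve hE1 hEcm
    exact isDivisorGenerated_prod_cmCurve_of_unitaryTypeOne hY4 hY2 φY hd hφY hm1 hE1 χ hd' hχ

/-- **The Hodge conjecture for everything isogenous to `Y × E`, `E` ANY elliptic curve**, `Y` simple of unitary type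
`(dim Y − 1, 1)`, `dim Y ≥ 4`, `dim_ℚ End⁰(Y) = 2` (with `B = D`). For `dim Y = 4` and `E` of CM type by `k ≅ ℚ(φ)`
this is Thm. 0.2 (3) (case (g) with `End⁰(X₂) = k`); otherwise Thm. 0.2 (4).
[cite: MoonenZarhin1999LowDim, Thm. 0.2 (3)–(4) and §3 Prop. (3.8)] [cite: vanGeemen1994HodgeAV, §3.6 (p. 236) and Lemma 3.7] -/
theorem hodgeConjectureFor_of_isIsogenous_prod_curve_of_isSimple_unitaryTypeOne {X : AbelianVariety ℂ}
    (hYs : Y.IsSimple) (hY4 : 4 ≤ Y.dim) (hY2 : Module.finrank ℚ Y.endAlgebra = 2) (φY : Y ⟶ Y) {d : ℕ}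
    (hd : 0 < d) (hφY : φY ≫ φY = -(d • 𝟙 Y))
    (hm1 : eigenMultiplicity Y φY (Complex.I * (Real.sqrt d : ℂ)) = 1 ∨
      eigenMultiplicity Y φY (-(Complex.I * (Real.sqrt d : ℂ))) = 1)
    (hE1 : E.dim = 1) (hX : AbelianVariety.IsIsogenous X (Y.prod E)) :
    IsDivisorGenerated X ∧ HodgeConjectureFor X.dim X.X :=
  have hD := (isDivisorGenerated_prod_curve_of_isSimple_unitaryTypeOne hYs hY4 hY2 φY hd hφY hm1 hE1).of_isIsogenous hX
  ⟨hD, hodgeConjectureFor_of_isDivisorGenerated _ hD⟩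

/- **On path**: the Hodge conjecture gives every target of this file (the tree's `hodgeConjectureFor_prod_of_hodgeConjecture'`);
this file proves them unconditionally. -/
example (h : ∀ ⦃n : ℕ⦄ ⦃S : Literature.AlgebraicGeometry.Motives.SchemeOver ℂ⦄,
      Literature.AlgebraicGeometry.Motives.IsSmoothProjective n S → HodgeConjectureFor n S) (X : AbelianVariety ℂ) :
    HodgeConjectureFor X.dim X.X :=
  h Literature.AlgebraicGeometry.Motives.AbelianVariety.isSmoothProjective_holds

end DivisorGenerated

end Literature.AlgebraicGeometry.HodgeTheory

end
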